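import Summits.QuantumFields.YangMills.Theses.FradkinShenkerFlow
import Literature.MathematicalPhysics.QuantumFieldTheory.BalabanSoftAveraging
import Summits.QuantumFields.YangMills.Theorems.SusceptibilityToPoincare.Negative.Bottleneck
import Summits.QuantumFields.YangMills.Theorems.SusceptibilityToPoincare.Negative.TwistSectorSimplyConnected
import Summits.QuantumFields.YangMills.Theorems.FradkinShenkerFlowSusceptibilityToPoincareJointMarginal
import Summits.QuantumFields.YangMills.Theorems.FradkinShenkerFlowSusceptibilityToPoincareReverseMartingaleVariance
import Summits.QuantumFields.YangMills.Theorems.FradkinShenkerFlowSusceptibilityToPoincareTruncFiltration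
import Summits.QuantumFields.YangMills.Theorems.FradkinShenkerFlowSusceptibilityToPoincareTerminalNecessity

/-!
# Line `rg-variance-cascade` — checked skeleton for crux stmt-QuantumFields-9441
(`Summit.QuantumFields.YangMills.Theses.FradkinShenkerFlow.SusceptibilityToPoincare`, FS(β) ⇒ UP(β))

LEAD'S RESHAPE v2 (lead `prover-line-stmt-QuantumFields-9441-a1-0`, 2026-08-16, cycle 1): the planner's stub A
`stub_varianceCascade` (M–L) is split AT THE SKELETON LEVEL into three independent, provable-now stubs —
A1 `stub_jointMarginal` (the joint law is a probability measure with fine marginal `μ_{β,S}`), A2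
`stub_reverseMartingaleVariance` (the abstract reverse-martingale variance identity for a finite decreasing filtration
ending at `⊥`, pure Mathlib vocabulary) and A3 `stub_truncFiltration` (the comap-filtration of the truncation maps is
measurable, decreasing and `⊥` at level `n`) — glued SORRY-FREE to the planner's statement `VarianceCascade`
(`varianceCascade_of`, `variance_map` + `variance_eq_integral`).  Stubs B, C, D, T are byte-identical to the planner's.
Registered stubs (7 = stubs_max): A1, A2, A3, B, C, D, T.

LEAD c3 (cycle 2, 2026-08-16T21Z), v2.4: stubs B C D T UNCHANGED (byte-identical); NEW sorry-free §5 "tightness" importing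
the landed necessity package (`Theorems/…TerminalNecessity.lean` p125968, `…OneLevelNecessity.lean` p125728, riders N1–N5, G1b):
`terminalPoincare_of_coreSC : CoreSC → TerminalPoincare` (D is implied by the restated crux — crux-sized, promote candidate) and
`aFine_le_of_up` (UP ⇒ B's fine clause).  B's level clauses and C are the genuine pinned-measure content (not implied by UP).

LEAD c4 (cycle 3, 2026-08-16T21:3xZ), v2.5: stubs B C D T UNCHANGED (byte-identical); NEW sorry-free §6 RESTATEMENT PACKAGE —
`crux_iff_coreSC_and_residual : crux ↔ CoreSC ∧ TypedDeclResidual` (the typed decl IS the restated core plus the sentinel, both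
sentinel halves refuted modulo the standing inputs in §4 / `Negative/TypedDeclResidualFalseOfTwistInputs.lean`), the centreless
companion `NonSimplyConnectedClustering` (FS ⇒ EC for `¬ SimplyConnectedSpace G` above a threshold; implied by the typed decl +
the PROVED item 9444, `nonSimplyConnectedClustering_of_crux`; pattern of the ConvexGribovBody split stmt-16404/16405), and
`closes_restated : CoreSC → NonSimplyConnectedClustering → PoincareToClustering → FiniteSusceptibilityWeakCoupling →
ClusteringToYangMills → YangMills` — the route's deciding theorem re-proved with 9441 replaced by the pair (C″, N), so the tenure
planner can restate by copying elaborated text; `yangMills_of_stubs` = the restated route from the registered stubs A–D + N + items.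

ROUTE-CHOICE rchoice-Summits-QuantumFields-YangMill-8bac143f (2026-08-16T19:1xZ, applied by lead a1-0 in v2.3): this assembly must
neither import `Negative/FalseOfTwistSectorInputs.lean` nor name the Literature constant of the twist-sector inputs; §4a takes
H written out verbatim (`typedDeclResidual_false_of_twistInputs_centreless`, via `Negative/Bottleneck`).  Leads: keep it so on
every re-publish.  (v2.2/v2.3 also: A1 p121343, A2 p120528, A3 p120476 landed and imported; registered open stubs = B, C, D, T.)

Planner `planner-cruxplan-stmt-QuantumFields-9441-rg-variance-cascade-0`, 2026-08-16 (crux-plan, round 2; idea card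
`Cruxes/SusceptibilityToPoincare/Ideas/rg-variance-cascade.md` (ideator 5); triage TRIAGE-r2-1 (sharpen 1–4), TRIAGE-r2-2
(s1–s5), TRIAGE-r2-3 (s1–s7) — all three `pass`, all three: "line candidate for the RESTATED crux; dead on arrival for the
decl AS TYPED").  Line card: `Lines/rg-variance-cascade.md`.

Crux (route FradkinShenkerFlow, rank 2): for every compact simple Lie group `G`, faithful unitary lattice representation
`r`, `β ≥ 0`: finite gauge-invariant susceptibility of the torus Wilson measures uniformly in the side `2S+1` (FS) ⟹ a
UNIFORM single-link heat-bath Poincaré inequality `Var_μ F ≤ C Σ_ℓ ∫∫ (F U − F(U[ℓ ↦ g]))² dν_ℓ^U dμ` for all bounded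
measurable `F` (UP).

## State of the crux this skeleton is written against (read 2026-08-16T18:00Z)

The decl AS TYPED is refuted modulo standing inputs on both sides of the `π₁` cut — `¬crux` modulo
the 't Hooft twist-sector inputs H (registered open Literature statement; Negative/FalseOfTwistSectorInputs.lean, p76563, NOT imported) (centreless `G`) and modulo the SU(2) mixed-action twist inputs (simply-connected `G`, reducible `r`, intermediate `β`;
`Negative/TwistSectorSimplyConnected`, p77766, which also kills crux + `SimplyConnectedSpace`) — with `crux ⇔ 4a ∧ 4b`
(Transfer, p80192); six lead seats, drefute, cdisprove, both round-2 ideators and the three round-2 triagers concur on the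
restatement C″ = `IsCompactSimpleLieGroup G → SimplyConnectedSpace G → ∀ r, ∃ β₁, ∀ β ≥ β₁, FS r β → UP r β` (PICKED.md c2,
crux NOTES.md).  Consequently EVERY skeleton concluding the typed decl by name carries a conditionally-refuted residual.  This
file isolates that residual in ONE sentinel stub and states every other stub pointwise in `(G, r, β)` inside the scope of
C″, so that the registered stubs transfer verbatim to the restated crux: `core_of` below IS the restated crux's `_of`
theorem (its conclusion `CoreSC` is C″ to the letter).

## The line: VARIANCE MARTINGALE DOWN A MULTI-RESOLUTION FAMILY OF SOFT COVARIANT BLOCK FIELDS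

Objects (all over tree/Mathlib declarations; §0 gives them short names for the sorry-free composition only).  Fix
`(G, r, β)`, a side `N = 2S+1`, a block base `b ≥ 2`, a number of levels `n ≥ 1` and a pin strength `s ≥ β`.  Level
`k < n` has block size `b^(k+1)`; its COARSE FIELD `V^k : GaugeConfig 4 (blockSide N b^(k+1)) G` is Bałaban's
gauge-COVARIANT hard block field of the FINE Wilson field `U` through the representative block mean — the straight
transporter between consecutive block corners (`BalabanAveraging.link N b^(k+1) (BlockMean.rep 0)`, `link_rep_zero`; the
decimation-type scheme, the only constructible one today, TRIAGE-r2-3 (c)) — smeared by the von Mises–Fisher density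
`exp(s Re tr r.ρ(V_e W_e⁻¹))` (the inhabitant-free soft step of the card; `IsGroupHeatKernel` has no SU(N) inhabitant).
All levels are computed FROM `U` (no intermediate lattices, no Markov chain of fields is needed): the JOINT LAW is
`P = (μ_{β,S} ⊗ Haar^{⊗ all coarse links}).tilted(Σ_k Σ_e s Re tr r.ρ(V^k_e (link U e)⁻¹))`, whose global normalisation
is the fibrewise vMF normalisation by right-invariance of Haar, so `P.fst = μ_{β,S}` EXACTLY (part of stub A).
The DECREASING FILTRATION `𝓖_j = σ(V^j, …, V^{n−1})` (`j = 0 … n`, `𝓖_n = ⊥`) is `MeasurableSpace.comap (T j)` of the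
truncation map keeping the levels `≥ j`; `𝓖_{k,e}` additionally forgets the coordinate `e` of level `k` (map `T' k e`).
With `f = F ∘ Prod.fst`, `F_k = E_P[f | 𝓖_k]`:
  `a(F)   = ∫ (f − F_0)²`                      fine fluctuation given ALL block fields (UV end, pinned at scale `b`),
  `A_k(F) = ∫ (F_k − F_{k+1})²`               = `E Var(F_k | 𝓖_{k+1})`, level-`k` fluctuation given the coarser fields,
  `A_{n−1}(F) = Var_P(F_{n−1})`               variance under the TERMINAL EFFECTIVE THEORY `Law(V^{n−1})` (IR end),
  `D_k(F) = Σ_e ∫ (F_k − E[f | 𝓖_{k,e}])²`    level-`k` single-coarse-link (heat-bath) Dirichlet form,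
  `HB(F)  = Σ_ℓ ∫∫ (F U − F(U[ℓ↦g]))² dν dμ`   the Wilson heat-bath form = the crux's right-hand side.
The reverse-martingale identity `Var_μ F = a + Σ_{k<n} A_k` is EXACT (stub A; the card's "lossless" claim in its correct
form UP ⟺ fluctuation ∧ coarse control, TRIAGE-r2-2 (s4)/r2-3 (s5)), and the gluing is real arithmetic (`cascade_arith`):
  `a ≤ γ·HB`, `A_k ≤ γ·D_k (k+1<n)` [stub B]  +  `D_0 ≤ κ·HB`, `D_{k+1} ≤ κ·D_k` [stub C]  +  `A_{n−1} ≤ C_T·D_{n−1}` [stub D]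
  ⟹ `Var_μ F ≤ (γ⁺ + max(γ, C_T)⁺ Σ_{k<n} (κ⁺)^(k+1)) · HB(F)`, every factor a fixed-(β, b, n, s) quantity — S-free by construction.

Stubs (five, registered; sizes are guesses):
  A `stub_varianceCascade`     [M–L, provable now, every compact G, every real β, s, every b, n, S] marginal identity
      `P.fst = μ` (Tonelli + right-invariance of Haar) + orthogonality of reverse-martingale differences for the nested
      comap-filtration (`condExp` tower/pull-out; `condExp_bot`) ⟹ `Var_μ F = a + Σ_k A_k`.  Reusable by ANY RG line.
  B `stub_fluctuationPoincare` [XL — the line's load-bearing UV research target] simply-connected compact simple G, r: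
      ∃ block base b ≥ 2, ∃ β₁, ∀ β ≥ β₁, ∀ n ≥ 1, ∀ s ≥ β, ∃ γ, ∀ S: ANNEALED fluctuation Poincaré at the fine level in
      ORIGINAL form (`a ≤ γ HB`, TRIAGE-r2-1 sharpen (4), r2-3 (s3)) and at every level `k+1 < n` (`A_k ≤ γ D_k`): "a block
      field pinned one scale up is massive by constraint" — Bałaban's constrained positivity pointed at a functional inequality
      (never printed for any lattice gauge theory: card lookup (iii), `Barriers/UVStabilityNonUniqueness` scope (a)).
  C `stub_dirichletCascade`    [L] same scope, ∀ b ≥ 2: the Dirichlet cascade `D_0 ≤ κ HB`, `D_{k+1} ≤ κ D_k` (coarse-link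
      sensitivity of a posterior mean = covariance against ONE local likelihood ratio; bounded ratios × decay of correlations
      of the pinned fluctuation measure; the honest diffusive factor `Π κ ≍ poly(ξ)`, Disproof §4 "β-free C refuted").
  D `stub_terminalPoincare`    [IMPORTED INFRARED INPUT — confinement-grade, the hardest] same scope, ∀ b ≥ 2: ∃ β₂, ∀ β ≥ β₂,
      FS(r, β) → ∃ n ≥ 1, s ≥ β, C_T, ∀ S: `Var_P(F_{n−1}) ≤ C_T · D_{n−1}(F)` — the terminal effective theory at block scale
      `b^n` (intended `≍ M·ξ(β)`: high temperature, Kantorovich–Dobrushin via the tree's `HeatBath.variance_le_of_kr`) has an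
      S-uniform single-link heat-bath gap.  This is "ξ(β) < ∞ in RG clothing" (TRIAGE-r2-2 (r3)); FS is its (possibly idle)
      hypothesis, as in the crux; both catalogued deaths and the U(1)₄ / SU(2)₅ Coulomb phases falsify THIS stub's analogue and
      no other (card (2), TRIAGE S1).
  T `stub_typedDeclResidual`   [SCOPE SENTINEL — refuted modulo the standing inputs, NOT TO BE STAFFED] "the typed decl
      follows from its weak-coupling simply-connected core": `∀ simple G, r, (SC G → ∃ β⋆ ∀ β ≥ β⋆, FS → UP) → ∀ β ≥ 0, FS → UP`.
      For centreless G the hypothesis is vacuous and T is 4b (dead modulo the twist-sector inputs H, written out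
      verbatim, PROVED below: `typedDeclResidual_false_of_twistInputs_centreless`); for SU(2) with the Bhanot–Creutz witness it is dead mod (SC SU(2) ∧ hW ∧
      C″(SU(2))) (PROVED below: `typedDeclResidual_false_of_twistInputsSU2`).  Registered ONLY so that
      `SusceptibilityToPoincare_of` type-checks against the decl as typed; it is deleted under restatement (A) = C″, where
      `core_of` is the whole composition.
Composition (sorry-free, §3): A–D ⟹ `CoreSC` (= C″) by `cascade_arith`; `CoreSC` + T ⟹ crux unfolded; `crux_iff`.

Quantifier hygiene (TRIAGE-r2-2 s1/s5, r2-3 s1): the SCHEME IS FIXED TEXTUALLY in every stub (rep-0 transporters, vMF pin,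
geometric block sizes `b^(k+1)`) — no `∃ scheme` per stub; B chooses the block base `b` (Bałaban needs it large), C and D
hold for every `b ≥ 2`, D chooses `(n, s)` after `β`, B and C are universal in `(n ≥ 1, s ≥ β)` with constants AFTER them
(`∀ β ≥ β₁ ∃ γ(β, n, s)`, r2-2 (s5)); `n ≥ 1` and `s ≥ β` exclude the degenerations in which B would contain UP itself
(`n = 0`: `𝓖_0 = ⊥`, `a = Var`; flat pin: posterior = prior, r2-2 "p ≡ 1"); huge `b` or `n` only saturate (`blockSide = 1`,
coarse links = Polyakov lines), finitely many small tori being absorbed in the constants (tree `perVolume_heatBathPoincare`).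

Disproof.lean v3 (`Cruxes/SusceptibilityToPoincare/Disproof.lean`, 0 sorry; no `_false_without_` theorem exists) — honoured:
  * §1 bottleneck (`flux_lower_bound_of_UP`, landed `Negative/Bottleneck.lean`, imported): a bottleneck family of μ makes
    one of B/C/D fail at a NAMED level — for SC G at β ≥ β₁ none is known (r2-2 (f), r2-3 (f)); for SO(3) it is the crossover
    level of B or D's terminal theory (card (2)) — outside B–D's scope, inside T.
  * §2 `susceptibilityToPoincare_false_of_twistSectorInputs` (p76563) and drefute's p77766: conceded; they refute exactly T
    (kernel-checked below), nothing else: B, C, D are C″-scoped.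
  * §2b `lintegral_heatBath_update` (landed `Negative/HeatBathExchange.lean`): the single-link exchangeability behind
    `HB = 2 Σ_ℓ E Var(F | U_{ℓᶜ})`, the `k = fine` instance of the conditional-variance currency of A–D.
  * §4 "per-S Poincaré true, all content is uniformity in S": every constant here is fixed-scale; "C independent of β
    refuted": C(β) ≍ poly(ξ(β))·e^{O(β)} here; "0 ≤ β possibly unnecessary": unused by A–D (thresholds instead).
  * §5 / StrongCoupling p113987 (`heatBathPoincare_smallBeta`): on [0, β₀(r)] UP holds outright; T's small-β content is
    genuinely only the window (β₀(r), β⋆), where the hW witness lives (`no_bottleneck_smallBeta`).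
  * Landed Negative lemmas checked against: Bottleneck (tool, no instance), FalseOfTwistSectorInputs (kills T only; NOT imported),
    TwistSectorSimplyConnected (kills T only), PlantedLinkPinningFalseOfTwistInputs / SparseLocalToGlobalTwistSU2 (planted
    S4, all β: avoided by B–D's threshold β₁ exactly as C″ avoids them).
Sorries: exactly the five `stub_*`.  Registered signatures are spelled over tree/Mathlib declarations only (`condExp`,
`MeasurableSpace.comap`, `Measure.prod/pi/tilted`, `BalabanAveraging.link/blockSide/BlockMean.rep`, `wilsonMeasure`,
`wilsonAction`, `haarProbability`, `Function.update`), the joint law and the truncation maps being introduced by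
`∀ P, P = … →`, `∀ T, (∀ j ω k, T j ω k = …) →` binders; the §0 vocabulary unfolds to them definitionally (`core_of` is
applied to the stubs themselves in `SusceptibilityToPoincare_of`, which is that check).
-/

namespace Summit.QuantumFields.YangMills.Cruxes.SusceptibilityToPoincare.RgVarianceCascade

open MeasureTheory ProbabilityTheory Filter Topology
open Literature.MathematicalPhysics.QuantumFieldTheory

noncomputable section

/-! ### §0 Vocabulary (transparent names for VERBATIM sub-formulas; used only in the sorry-free composition) -/

section Vocabulary

variable {G : Type} [Group G] [TopologicalSpace G] [IsTopologicalGroup G] [CompactSpace G]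
  [MeasurableSpace G] [BorelSpace G]

/-- FS(r, β): finite gauge-invariant susceptibility uniformly in the volume — verbatim the crux hypothesis. -/
def FS (r : LatticeRep G) (β : ℝ) : Prop :=
  ∀ A B : YMSpecies G, ∃ χ : ℝ, ∀ S : ℕ, ∑ x ∈ Literature.Probability.LatticeModels.box 4 S,
    |covariance (fun U => A.F (Literature.MathematicalPhysics.QuantumLattice.torusLift (2 * S + 1) U))
      (fun U => B.F (Literature.MathematicalPhysics.QuantumLattice.configShift (-x)
          (Literature.MathematicalPhysics.QuantumLattice.torusLift (2 * S + 1) U)))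
      (wilsonMeasure r.ρ β : Measure (GaugeConfig 4 (2 * S + 1) G))| ≤ χ

/-- UP(r, β): the uniform single-link heat-bath Poincaré inequality for ALL bounded measurable `F` — verbatim the
crux conclusion. -/
def UP (r : LatticeRep G) (β : ℝ) : Prop :=
  ∃ C : ℝ, ∀ S : ℕ, ∀ F : GaugeConfig 4 (2 * S + 1) G → ℝ, Measurable F → (∃ M : ℝ, ∀ U, |F U| ≤ M) →
    variance F (wilsonMeasure r.ρ β : Measure (GaugeConfig 4 (2 * S + 1) G)) ≤
      C * ∑ ℓ : Edge 4 (2 * S + 1), ∫ U, ∫ g, (F U - F (Function.update U ℓ g)) ^ 2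
        ∂((haarProbability G).tilted (fun g' => -β * wilsonAction r.ρ (Function.update U ℓ g')))
        ∂(wilsonMeasure r.ρ β : Measure (GaugeConfig 4 (2 * S + 1) G))

/-- The Wilson heat-bath form `HB(F) = Σ_ℓ ∫∫ (F U − F(U[ℓ ↦ g]))² dν_ℓ^U dμ_{β,S}` (the crux's right-hand side). -/
def HB (r : LatticeRep G) (β : ℝ) (S : ℕ) (F : GaugeConfig 4 (2 * S + 1) G → ℝ) : ℝ :=
  ∑ ℓ : Edge 4 (2 * S + 1), ∫ U, ∫ g, (F U - F (Function.update U ℓ g)) ^ 2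
    ∂((haarProbability G).tilted (fun g' => -β * wilsonAction r.ρ (Function.update U ℓ g')))
    ∂(wilsonMeasure r.ρ β : Measure (GaugeConfig 4 (2 * S + 1) G))

/-- Coarse configurations at level `k` (block size `b^(k+1)`) over the fine torus of side `2S+1`. -/
abbrev Coarse (G : Type) (S b n : ℕ) (k : Fin n) : Type :=
  GaugeConfig 4 (BalabanAveraging.blockSide (2 * S + 1) (b ^ ((k : ℕ) + 1))) G

/-- All coarse fields `(V^k)_{k<n}`. -/
abbrev CoarseAll (G : Type) (S b n : ℕ) : Type := (k : Fin n) → Coarse G S b n k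

/-- The multi-resolution space: the fine field and all coarse fields. -/
abbrev CSpace (G : Type) (S b n : ℕ) : Type := GaugeConfig 4 (2 * S + 1) G × CoarseAll G S b n

variable (r : LatticeRep G) (β : ℝ) (S b n : ℕ) [NeZero b] (s : ℝ)

/-- The JOINT LAW `P` of the fine Wilson field `U ~ μ_{β,S}` and its vMF-smeared straight-transporter block fields at
all levels: `(μ ⊗ Haar^{⊗ coarse}).tilted (Σ_k Σ_e s · Re tr r.ρ(V^k_e · (link U e)⁻¹))` (global tilt = fibrewise
von Mises–Fisher normalisation by right-invariance of Haar, so `P.fst = μ`). -/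
def jointMeasure : Measure (CSpace G S b n) :=
  ((wilsonMeasure r.ρ β : Measure (GaugeConfig 4 (2 * S + 1) G)).prod
    (Measure.pi fun k : Fin n => Measure.pi
      fun _ : Edge 4 (BalabanAveraging.blockSide (2 * S + 1) (b ^ ((k : ℕ) + 1))) => haarProbability G)).tilted
    (fun ω => ∑ k : Fin n, ∑ e : Edge 4 (BalabanAveraging.blockSide (2 * S + 1) (b ^ ((k : ℕ) + 1))),
      s * (r.ρ (ω.2 k e * (BalabanAveraging.link (2 * S + 1) (b ^ ((k : ℕ) + 1))
        (BalabanAveraging.BlockMean.rep 0) ω.1 e)⁻¹)).trace.re)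

/-- Truncation keeping the coarse levels `≥ j` (`𝓖_j = comap (trunc j)`; `trunc n` is constant, `𝓖_n = ⊥`). -/
def trunc (j : ℕ) (ω : CSpace G S b n) : CoarseAll G S b n :=
  fun k => if j ≤ (k : ℕ) then ω.2 k else fun _ => 1

/-- Truncation keeping the levels `≥ k` except the coordinate `e` of level `k` (`𝓖_{k,e} = comap (truncAt k e)`). -/
def truncAt (k : Fin n) (e : Edge 4 (BalabanAveraging.blockSide (2 * S + 1) (b ^ ((k : ℕ) + 1))))
    (ω : CSpace G S b n) : CoarseAll G S b n :=
  fun i => if (k : ℕ) ≤ (i : ℕ) then Function.update ω.2 k (Function.update (ω.2 k) e 1) i else fun _ => 1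

variable {S b n}
variable (P : Measure (CSpace G S b n)) (T : ℕ → CSpace G S b n → CoarseAll G S b n)
  (T' : (k : Fin n) → Edge 4 (BalabanAveraging.blockSide (2 * S + 1) (b ^ ((k : ℕ) + 1))) →
    CSpace G S b n → CoarseAll G S b n)

/-- `a(F) = ∫ (F∘fst − E_P[F∘fst | 𝓖_0])² dP`: the fine fluctuation given all block fields. -/
def aFine (F : GaugeConfig 4 (2 * S + 1) G → ℝ) : ℝ :=
  ∫ ω, (F ω.1 - condExp (MeasurableSpace.comap (T 0) inferInstance) P (F ∘ Prod.fst) ω) ^ 2 ∂P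

/-- `A_k(F) = ∫ (E_P[f | 𝓖_k] − E_P[f | 𝓖_{k+1}])² dP`: the level-`k` martingale increment (`A_{n−1} = Var_P E[f | 𝓖_{n−1}]`). -/
def aLev (k : Fin n) (F : GaugeConfig 4 (2 * S + 1) G → ℝ) : ℝ :=
  ∫ ω, (condExp (MeasurableSpace.comap (T k) inferInstance) P (F ∘ Prod.fst) ω -
    condExp (MeasurableSpace.comap (T ((k : ℕ) + 1)) inferInstance) P (F ∘ Prod.fst) ω) ^ 2 ∂P

/-- `D_k(F) = Σ_e ∫ (E_P[f | 𝓖_k] − E_P[f | 𝓖_{k,e}])² dP`: the level-`k` single-coarse-link Dirichlet form. -/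
def dLev (k : Fin n) (F : GaugeConfig 4 (2 * S + 1) G → ℝ) : ℝ :=
  ∑ e : Edge 4 (BalabanAveraging.blockSide (2 * S + 1) (b ^ ((k : ℕ) + 1))),
    ∫ ω, (condExp (MeasurableSpace.comap (T k) inferInstance) P (F ∘ Prod.fst) ω -
      condExp (MeasurableSpace.comap (T' k e) inferInstance) P (F ∘ Prod.fst) ω) ^ 2 ∂P

omit [NeZero b] in
/-- The Wilson heat-bath form is non-negative. -/
theorem HB_nonneg (F : GaugeConfig 4 (2 * S + 1) G → ℝ) : 0 ≤ HB r β S F :=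
  Finset.sum_nonneg fun _ _ => integral_nonneg fun _ => integral_nonneg fun _ => sq_nonneg _

omit [Group G] [TopologicalSpace G] [IsTopologicalGroup G] [CompactSpace G] [BorelSpace G] in
/-- The level forms are non-negative. -/
theorem dLev_nonneg (k : Fin n) (F : GaugeConfig 4 (2 * S + 1) G → ℝ) : 0 ≤ dLev P T T' k F :=
  Finset.sum_nonneg fun _ _ => integral_nonneg fun _ => sq_nonneg _

end Vocabulary

/-- The crux, re-read through `FS`/`UP` (definitional). -/
theorem crux_iff :
    Summit.QuantumFields.YangMills.Theses.FradkinShenkerFlow.SusceptibilityToPoincare ↔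
      ∀ (G : Type) [Group G] [TopologicalSpace G] [IsTopologicalGroup G] [CompactSpace G]
        [MeasurableSpace G] [BorelSpace G], IsCompactSimpleLieGroup G →
        ∀ (r : LatticeRep G) (β : ℝ), 0 ≤ β → FS r β → UP r β :=
  Iff.rfl

/-- **C″ — the consensus restatement of the crux** (leads r-0, -1, c1, c2, drefute p77766, cdisprove, TRIAGE-r2 ×3, PICKED.md):
`IsCompactSimpleLieGroup G → SimplyConnectedSpace G → ∀ r, ∃ β₁, ∀ β ≥ β₁, FS r β → UP r β`.  The conclusion of `core_of`. -/
def CoreSC : Prop :=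
  ∀ (G : Type) [Group G] [TopologicalSpace G] [IsTopologicalGroup G] [CompactSpace G]
    [MeasurableSpace G] [BorelSpace G], IsCompactSimpleLieGroup G → SimplyConnectedSpace G →
    ∀ (r : LatticeRep G), ∃ β₁ : ℝ, ∀ β : ℝ, β₁ ≤ β → FS r β → UP r β

/-! ### §1 Statements of the five stubs as named propositions (for the sorry-free composition) -/

/-- Statement of stub A `stub_varianceCascade`. -/
def VarianceCascade : Prop :=
  ∀ (G : Type) [Group G] [TopologicalSpace G] [IsTopologicalGroup G] [CompactSpace G]
    [MeasurableSpace G] [BorelSpace G] (r : LatticeRep G) (β : ℝ) (b : ℕ) [NeZero b] (n : ℕ) (s : ℝ) (S : ℕ)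
    (P : Measure (CSpace G S b n)), P = jointMeasure r β S b n s →
    ∀ (T : ℕ → CSpace G S b n → CoarseAll G S b n), (∀ j ω k, T j ω k = trunc S b n j ω k) →
    ∀ (F : GaugeConfig 4 (2 * S + 1) G → ℝ), Measurable F → (∃ M : ℝ, ∀ U, |F U| ≤ M) →
    variance F (wilsonMeasure r.ρ β : Measure (GaugeConfig 4 (2 * S + 1) G)) = aFine P T F + ∑ k : Fin n, aLev P T k F

/-- Statement of stub A1 `stub_jointMarginal` (lead's reshape v2). -/
def JointMarginal : Prop :=
  ∀ (G : Type) [Group G] [TopologicalSpace G] [IsTopologicalGroup G] [CompactSpace G]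
    [MeasurableSpace G] [BorelSpace G] (r : LatticeRep G) (β : ℝ) (b : ℕ) [NeZero b] (n : ℕ) (s : ℝ) (S : ℕ)
    (P : Measure (CSpace G S b n)), P = jointMeasure r β S b n s →
    IsProbabilityMeasure P ∧ P.map Prod.fst = (wilsonMeasure r.ρ β : Measure (GaugeConfig 4 (2 * S + 1) G))

/-- Statement of stub A2 `stub_reverseMartingaleVariance` (lead's reshape v2; abstract probability). -/
def ReverseMartingaleVariance : Prop :=
  ∀ (Ω : Type) [mΩ : MeasurableSpace Ω] (P : Measure Ω) [IsProbabilityMeasure P] (n : ℕ)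
    (m : ℕ → MeasurableSpace Ω), (∀ j, m j ≤ mΩ) → (∀ j, m (j + 1) ≤ m j) → m n = ⊥ →
    ∀ (f : Ω → ℝ), Measurable f → (∃ M : ℝ, ∀ ω, |f ω| ≤ M) →
    ∫ ω, (f ω - ∫ ω', f ω' ∂P) ^ 2 ∂P =
      (∫ ω, (f ω - condExp (m 0) P f ω) ^ 2 ∂P) +
      ∑ k : Fin n, ∫ ω, (condExp (m k) P f ω - condExp (m ((k : ℕ) + 1)) P f ω) ^ 2 ∂P

/-- Statement of stub A3 `stub_truncFiltration` (lead's reshape v2). -/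
def TruncFiltration : Prop :=
  ∀ (G : Type) [Group G] [MeasurableSpace G] (S b n : ℕ)
    (T : ℕ → CSpace G S b n → CoarseAll G S b n),
    (∀ j ω k, T j ω k = if j ≤ (k : ℕ) then ω.2 k else fun _ => 1) →
    (∀ j : ℕ, MeasurableSpace.comap (T j) inferInstance ≤ (inferInstance : MeasurableSpace (CSpace G S b n))) ∧
    (∀ j : ℕ, MeasurableSpace.comap (T (j + 1)) inferInstance ≤
      (MeasurableSpace.comap (T j) inferInstance : MeasurableSpace (CSpace G S b n))) ∧
    MeasurableSpace.comap (T n) inferInstance = (⊥ : MeasurableSpace (CSpace G S b n))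

/-- Statement of stub B `stub_fluctuationPoincare`. -/
def FluctuationPoincare : Prop :=
  ∀ (G : Type) [Group G] [TopologicalSpace G] [IsTopologicalGroup G] [CompactSpace G]
    [MeasurableSpace G] [BorelSpace G], IsCompactSimpleLieGroup G → SimplyConnectedSpace G → ∀ (r : LatticeRep G),
    ∃ (b : ℕ) (_ : NeZero b), 2 ≤ b ∧ ∃ β₁ : ℝ, ∀ β : ℝ, β₁ ≤ β → ∀ (n : ℕ), 1 ≤ n → ∀ (s : ℝ), β ≤ s →
    ∃ γ : ℝ, ∀ (S : ℕ) (P : Measure (CSpace G S b n)), P = jointMeasure r β S b n s →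
    ∀ (T : ℕ → CSpace G S b n → CoarseAll G S b n), (∀ j ω k, T j ω k = trunc S b n j ω k) →
    ∀ (T' : (k : Fin n) → Edge 4 (BalabanAveraging.blockSide (2 * S + 1) (b ^ ((k : ℕ) + 1))) →
      CSpace G S b n → CoarseAll G S b n), (∀ k e ω i, T' k e ω i = truncAt S b n k e ω i) →
    ∀ (F : GaugeConfig 4 (2 * S + 1) G → ℝ), Measurable F → (∃ M : ℝ, ∀ U, |F U| ≤ M) →
    aFine P T F ≤ γ * HB r β S F ∧ ∀ k : Fin n, (k : ℕ) + 1 < n → aLev P T k F ≤ γ * dLev P T T' k F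

/-- Statement of stub C `stub_dirichletCascade`. -/
def DirichletCascade : Prop :=
  ∀ (G : Type) [Group G] [TopologicalSpace G] [IsTopologicalGroup G] [CompactSpace G]
    [MeasurableSpace G] [BorelSpace G], IsCompactSimpleLieGroup G → SimplyConnectedSpace G →
    ∀ (r : LatticeRep G) (b : ℕ) [NeZero b], 2 ≤ b →
    ∃ β₁ : ℝ, ∀ β : ℝ, β₁ ≤ β → ∀ (n : ℕ), 1 ≤ n → ∀ (s : ℝ), β ≤ s →
    ∃ κ : ℝ, ∀ (S : ℕ) (P : Measure (CSpace G S b n)), P = jointMeasure r β S b n s →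
    ∀ (T : ℕ → CSpace G S b n → CoarseAll G S b n), (∀ j ω k, T j ω k = trunc S b n j ω k) →
    ∀ (T' : (k : Fin n) → Edge 4 (BalabanAveraging.blockSide (2 * S + 1) (b ^ ((k : ℕ) + 1))) →
      CSpace G S b n → CoarseAll G S b n), (∀ k e ω i, T' k e ω i = truncAt S b n k e ω i) →
    ∀ (F : GaugeConfig 4 (2 * S + 1) G → ℝ), Measurable F → (∃ M : ℝ, ∀ U, |F U| ≤ M) →
    (∀ k : Fin n, (k : ℕ) = 0 → dLev P T T' k F ≤ κ * HB r β S F) ∧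
      ∀ k k' : Fin n, (k' : ℕ) = (k : ℕ) + 1 → dLev P T T' k' F ≤ κ * dLev P T T' k F

/-- Statement of stub D `stub_terminalPoincare`. -/
def TerminalPoincare : Prop :=
  ∀ (G : Type) [Group G] [TopologicalSpace G] [IsTopologicalGroup G] [CompactSpace G]
    [MeasurableSpace G] [BorelSpace G], IsCompactSimpleLieGroup G → SimplyConnectedSpace G →
    ∀ (r : LatticeRep G) (b : ℕ) [NeZero b], 2 ≤ b →
    ∃ β₂ : ℝ, ∀ β : ℝ, β₂ ≤ β → FS r β →
    ∃ n : ℕ, 1 ≤ n ∧ ∃ s : ℝ, β ≤ s ∧ ∃ C : ℝ, ∀ (S : ℕ) (P : Measure (CSpace G S b n)), P = jointMeasure r β S b n s →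
    ∀ (T : ℕ → CSpace G S b n → CoarseAll G S b n), (∀ j ω k, T j ω k = trunc S b n j ω k) →
    ∀ (T' : (k : Fin n) → Edge 4 (BalabanAveraging.blockSide (2 * S + 1) (b ^ ((k : ℕ) + 1))) →
      CSpace G S b n → CoarseAll G S b n), (∀ k e ω i, T' k e ω i = truncAt S b n k e ω i) →
    ∀ (F : GaugeConfig 4 (2 * S + 1) G → ℝ), Measurable F → (∃ M : ℝ, ∀ U, |F U| ≤ M) →
    ∀ k : Fin n, (k : ℕ) + 1 = n → aLev P T k F ≤ C * dLev P T T' k F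

/-- Statement of stub T `stub_typedDeclResidual` (scope sentinel). -/
def TypedDeclResidual : Prop :=
  ∀ (G : Type) [Group G] [TopologicalSpace G] [IsTopologicalGroup G] [CompactSpace G]
    [MeasurableSpace G] [BorelSpace G], IsCompactSimpleLieGroup G → ∀ (r : LatticeRep G),
    (SimplyConnectedSpace G → ∃ β₁ : ℝ, ∀ β : ℝ, β₁ ≤ β → FS r β → UP r β) →
    ∀ β : ℝ, 0 ≤ β → FS r β → UP r β

/-! ### §2 The registered stubs (`sorry` only here) -/

/-! #### Stub A of the planner, reshaped (lead a1-0, v2) into A1 + A2 + A3; `VarianceCascade` follows sorry-free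
(`varianceCascade_of`, §3).  The planner's informal proof of A is exactly (i) = A1, (ii) = A3, (iii) = A2. -/

/-- `stub_jointMarginal` — **A1, the fine marginal of the joint law is the Wilson measure** (provable now, size M).
For EVERY compact `G`, lattice representation `r`, real `β`, block base `b ≥ 1`, `n`, `s` and side `2S+1`: the joint law
`P = (μ_{β,S} ⊗ Haar^{⊗coarse}).tilted(Σ_k Σ_e s Re tr ρ(V^k_e (link U e)⁻¹))` is a probability measure and its image
under `Prod.fst` is `μ_{β,S}`.
Proof.  The tilt function `Φ(U, V) = Σ_k Σ_e φ(V^k_e · h_{k,e}(U)⁻¹)`, `φ(g) = s Re tr r.ρ g`, is bounded (`|Re tr ρ g| ≤ N`,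
unitarity `r.mem_unitary`) and measurable (`r.continuous`; `BalabanAveraging.measurable_link` with `MeasurableMul₂ G`,
`MeasurableInv G` from `LatticeRep.secondCountableTopology r` + `BorelSpace`), so `exp Φ` is integrable against the
probability measure `μ ⊗ π` (`isProbabilityMeasure_wilsonMeasure r.continuous`, `Measure.pi` of `haarProbability`) and
`P` is a probability measure (`isProbabilityMeasure_tilted`).  MARGINAL: for fixed `U` the `π`-integral of `exp Φ(U, ·)`
factorises over the coarse coordinates (`Measure.pi`, product of one-coordinate functions: `integral_fintype_prod_eq_prod`
twice, or `Measure.pi` as an iterated product) into `Π_k Π_e ∫ exp φ(v h_{k,e}(U)⁻¹) dHaar(v) = Π_k Π_e ∫ exp φ(v) dHaar(v)`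
by RIGHT-invariance of the Haar probability measure of the compact group (`haarProbability.instIsMulRightInvariant`,
`integral_mul_right_eq_self`) — a constant `c` independent of `U`; hence (Tonelli on `Measure.prod`, `withDensity`/`tilted`,
`Measure.map_apply` on rectangles `A ×ˢ univ` or `Measure.ext_prod`-style uniqueness on the product σ-algebra's fst-cylinders)
`P.map fst = (c / Z) • μ` with `Z = ∫ exp Φ d(μ ⊗ π) = c` (`μ` a probability measure), i.e. `P.map fst = μ`. -/
theorem stub_jointMarginal :
    ∀ (G : Type) [Group G] [TopologicalSpace G] [IsTopologicalGroup G] [CompactSpace G]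
      [MeasurableSpace G] [BorelSpace G] (r : LatticeRep G) (β : ℝ) (b : ℕ) [NeZero b] (n : ℕ) (s : ℝ) (S : ℕ)
      (P : Measure (GaugeConfig 4 (2 * S + 1) G ×
          ((k : Fin n) → GaugeConfig 4 (BalabanAveraging.blockSide (2 * S + 1) (b ^ ((k : ℕ) + 1))) G))),
      P = ((wilsonMeasure r.ρ β : Measure (GaugeConfig 4 (2 * S + 1) G)).prod
          (Measure.pi fun k : Fin n => Measure.pi
            fun _ : Edge 4 (BalabanAveraging.blockSide (2 * S + 1) (b ^ ((k : ℕ) + 1))) => haarProbability G)).tilted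
          (fun ω => ∑ k : Fin n, ∑ e : Edge 4 (BalabanAveraging.blockSide (2 * S + 1) (b ^ ((k : ℕ) + 1))),
            s * (r.ρ (ω.2 k e * (BalabanAveraging.link (2 * S + 1) (b ^ ((k : ℕ) + 1))
              (BalabanAveraging.BlockMean.rep 0) ω.1 e)⁻¹)).trace.re) →
      IsProbabilityMeasure P ∧ P.map Prod.fst = (wilsonMeasure r.ρ β : Measure (GaugeConfig 4 (2 * S + 1) G)) :=
  -- LANDED (wave 1, p121343): `Theorems/FradkinShenkerFlowSusceptibilityToPoincareJointMarginal.lean`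
  Summit.QuantumFields.YangMills.Theorems.SusceptibilityToPoincare.RgVarianceCascade.stub_jointMarginal

/-- `stub_reverseMartingaleVariance` — **A2, the reverse-martingale variance identity** (abstract probability; provable
now, size M).  On a probability space `(Ω, P)` with a finite DECREASING family of sub-σ-algebras
`m 0 ≥ m 1 ≥ … ≥ m n = ⊥` (all `≤` the ambient one), every bounded measurable `f` satisfies
`∫ (f − ∫ f)² dP = ∫ (f − E[f | m 0])² dP + Σ_{k<n} ∫ (E[f | m k] − E[f | m (k+1)])² dP`.
Proof.  TELESCOPE: `E[f | m n] = E[f | ⊥] = ∫ f dP` (`condExp_bot`), so pointwise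
`f − ∫ f = (f − E[f|m 0]) + Σ_{k<n} (E[f|m k] − E[f|m (k+1)])` (`Finset.sum_range_sub'`-type telescoping over `Fin n`).
ORTHOGONALITY in `L²(P)`: all terms are bounded (`ae_bdd_abs_condExp_of_ae_bdd_abs` / `condExp` of a bounded function is a.e.
bounded; or work with `MemLp _ 2`: `memLp_top_of_bound` → `MemLp.mono_exponent`, `integrable_condExp`, `MemLp.condExp`) and
(a) `∫ (f − E[f|m 0]) · h = 0` for every bounded `m 0`-strongly-measurable `h` (`integral_condExp`, pull-out
`condExp_mul_of_stronglyMeasurable_left`/`condExp_stronglyMeasurable_mul_of_bound`), each difference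
`E[f|m k] − E[f|m (k+1)]` being `m 0`-measurable (`stronglyMeasurable_condExp.mono (m k ≤ m 0)`, antitonicity by induction
from `∀ j, m (j+1) ≤ m j`); (b) for `j < k`, `∫ (E[f|m j] − E[f|m (j+1)]) · h = ∫ f h − ∫ f h = 0` for bounded
`m (j+1)`-measurable `h` (tower `condExp_condExp_of_le`, and the `k`-th difference is `m k ≤ m (j+1)`-measurable).
Expanding the square of the sum (`Finset.sum_mul_sum`, `integral_finset_sum`, `integral_add/sub` with integrability of
bounded products) kills every cross term.  (`n = 0`: the sum is empty and `m 0 = ⊥`, both sides are `∫ (f − ∫ f)²`.) [folklore] -/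
theorem stub_reverseMartingaleVariance :
    ∀ (Ω : Type) [mΩ : MeasurableSpace Ω] (P : Measure Ω) [IsProbabilityMeasure P] (n : ℕ)
      (m : ℕ → MeasurableSpace Ω), (∀ j, m j ≤ mΩ) → (∀ j, m (j + 1) ≤ m j) → m n = ⊥ →
      ∀ (f : Ω → ℝ), Measurable f → (∃ M : ℝ, ∀ ω, |f ω| ≤ M) →
      ∫ ω, (f ω - ∫ ω', f ω' ∂P) ^ 2 ∂P =
        (∫ ω, (f ω - condExp (m 0) P f ω) ^ 2 ∂P) +
        ∑ k : Fin n, ∫ ω, (condExp (m k) P f ω - condExp (m ((k : ℕ) + 1)) P f ω) ^ 2 ∂P :=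
  -- LANDED (wave 1, p120528): `Theorems/FradkinShenkerFlowSusceptibilityToPoincareReverseMartingaleVariance.lean`
  Summit.QuantumFields.YangMills.Theorems.SusceptibilityToPoincare.RgVarianceCascade.stub_reverseMartingaleVariance

/-- `stub_truncFiltration` — **A3, the truncation maps generate a decreasing filtration ending at `⊥`** (provable now,
size S).  For the truncation `T j ω = (k ↦ if j ≤ k then ω.2 k else 1)` keeping the coarse levels `≥ j` of
`ω = (U, V) ∈ GaugeConfig × Π_k Coarse_k`: every `T j` is measurable (`measurable_pi_lambda`; each component is a coordinate
projection of `ω.2` or a constant), so `comap (T j) ≤` the product σ-algebra (`Measurable.comap_le`); `T (j+1) = g_j ∘ T j`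
with the measurable overwrite `g_j c = (k ↦ if j+1 ≤ k then c k else 1)`, so `comap (T (j+1)) = comap (T j) (comap g_j _) ≤
comap (T j) _` (`MeasurableSpace.comap_comp`, `comap_mono`); and `T n` is the constant map (`k < n` for `k : Fin n`), so
`comap (T n) _ = ⊥` (`MeasurableSpace.comap_const` after `funext`). [folklore] -/
theorem stub_truncFiltration :
    ∀ (G : Type) [Group G] [MeasurableSpace G] (S b n : ℕ)
      (T : ℕ → GaugeConfig 4 (2 * S + 1) G ×
          ((k : Fin n) → GaugeConfig 4 (BalabanAveraging.blockSide (2 * S + 1) (b ^ ((k : ℕ) + 1))) G) →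
          ((k : Fin n) → GaugeConfig 4 (BalabanAveraging.blockSide (2 * S + 1) (b ^ ((k : ℕ) + 1))) G)),
      (∀ j ω k, T j ω k = if j ≤ (k : ℕ) then ω.2 k else fun _ => 1) →
      (∀ j : ℕ, MeasurableSpace.comap (T j) inferInstance ≤
        (inferInstance : MeasurableSpace (GaugeConfig 4 (2 * S + 1) G ×
          ((k : Fin n) → GaugeConfig 4 (BalabanAveraging.blockSide (2 * S + 1) (b ^ ((k : ℕ) + 1))) G)))) ∧
      (∀ j : ℕ, MeasurableSpace.comap (T (j + 1)) inferInstance ≤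
        (MeasurableSpace.comap (T j) inferInstance : MeasurableSpace (GaugeConfig 4 (2 * S + 1) G ×
          ((k : Fin n) → GaugeConfig 4 (BalabanAveraging.blockSide (2 * S + 1) (b ^ ((k : ℕ) + 1))) G)))) ∧
      MeasurableSpace.comap (T n) inferInstance =
        (⊥ : MeasurableSpace (GaugeConfig 4 (2 * S + 1) G ×
          ((k : Fin n) → GaugeConfig 4 (BalabanAveraging.blockSide (2 * S + 1) (b ^ ((k : ℕ) + 1))) G))) :=
  -- LANDED (wave 1, p120476): `Theorems/FradkinShenkerFlowSusceptibilityToPoincareTruncFiltration.lean`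
  Summit.QuantumFields.YangMills.Theorems.SusceptibilityToPoincare.RgVarianceCascade.stub_truncFiltration

/-- `stub_fluctuationPoincare` — **ANNEALED FLUCTUATION POINCARÉ AT EVERY SCALE: a block field pinned one scale up is
massive by constraint** (B; XL — the line's load-bearing UV research target; card P1, TRIAGE-r2-1 sharpen (4), r2-2 (s3)/(s5),
r2-3 (s3)/(s4)).  For compact simple SIMPLY-CONNECTED `G` and faithful unitary `r` there is a block base `b ≥ 2` (the prover's
choice — Bałaban's averaging needs a large block factor) and `β₁ = β₁(G, r, b)` such that for all `β ≥ β₁`, all `n ≥ 1`, all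
pin strengths `s ≥ β` there is `γ = γ(G, r, b, β, n, s)` with, for EVERY side `2S+1` and bounded measurable `F`:
  (fine level, ORIGINAL form)  `∫ (F∘fst − E_P[F∘fst | 𝓖_0])² dP ≤ γ · HB(F)` — the fine Wilson field conditioned on ALL
  its block fields (dominated by the finest, scale `b`) satisfies a Poincaré inequality w.r.t. the UNPINNED Wilson heat-bath
  form, uniformly in the volume (annealed = averaged over the pins under `P`; `E Var(F | U_{ℓᶜ}, V) ≤ E Var(F | U_{ℓᶜ})`
  makes the original form the weaker, correct one);
  (levels `k` with `k+1 < n`)  `∫ (F_k − F_{k+1})² dP ≤ γ · Σ_e ∫ (F_k − E_P[f | 𝓖_{k,e}])² dP` — the block field `V^k`,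
  conditioned on the coarser block fields, satisfies a Poincaré inequality w.r.t. single-coarse-link resampling.
WHY PLAUSIBLE.  Tree level: conditioning a lattice free field on its straight transporters over a grid of spacing `B`
pins a codimension-3 frame, capacity count ⟹ mass² `≍ B⁻³` (`≍ B⁻²` for true block AVERAGES, Poincaré–Wirtinger /
Bałaban's `Δ + aQ*Q ≥ cB⁻²`, CMP 95/96) — S-UNIFORM at fixed `b` either way (TRIAGE-r2-3 (c)); the pin width `s^{-1/2} ≤
β^{-1/2}` matches the field's own fluctuation, so the posterior is genuinely constrained (r2-2: flat pins would give
posterior = prior and this stub would BE UP); at levels `k ≥ 1` the rep-0 transporter of level `k+1` is the ordered product of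
`b` level-`k` transporters along the same line (nested corner grids `b^(k+1)ℤ ⊃ b^(k+2)ℤ`), so "`V^k` given `V^{k+1}`" is
`b` group elements softly constrained by their product — a LOCAL finite problem per coarse line, coupled only through `U`.
Large fields are `e^{−p(β)}`-rare and local (chessboard / Bałaban R-operation) and cost `e^{O(β)}` in `γ`, not `S`
(Menz–Schlichting arXiv:1202.1510 multi-well constants; Yau's entropy route CMP 181 if run for LSI).  No V-blind S-growing slow
mode is known for SC `G` at `β ≥ β₁` (r2-2 (f), r2-3 (f): instanton number not lattice-conserved; thin vortex sheets
`e^{−2β·area}`, local and unstable; torons VISIBLE to the block fields; corner gauge frames Haar-fast and removable on the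
invariant σ-algebra, p80192).  WHY THE SCOPE: for centreless `G` (SO(3)) the twist label is read by `V^k` while `b^(k+1) ≲ ξ`
and lost beyond — at the crossover level `A_k ≈ Var(twist) = O(1)` while `D_k ≈ 0` (resampling ONE coarse link of a smooth
coarse field cannot change its topological class): the bottleneck of Disproof §1 reappears HERE for SO(3) (card (2), r2-1),
hence `SimplyConnectedSpace G`; `β ≥ β₁(G, r, b)` puts every summand of `r` at weak coupling and excludes bulk transitions and
the Bhanot–Creutz window of p77766 (where the SU(2)-valued transporters of `ρ_{1/2} ⊕ kρ₁` carry disordered signs, the block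
field is noise and this stub would again be UP, r2-2).  `n ≥ 1`: with `n = 0`, `𝓖_0 = ⊥` and the fine clause IS UP.
Sources: Balaban1984Propagators (CMP 95) §2, doi:10.1007/bf01240221 (CMP 96), Balaban1985Averaging (CMP 98) (42)–(43);
Dimock arXiv:1108.1335, 1212.5562 (torus re-expositions); Lu–Yau CMP 156 doi:10.1007/bf02098489 and
Grunewald–Otto–Villani–Westdickenberg doi:10.1214/07-aihp200 (two-scale martingale / LSI); BauerschmidtBodineau arXiv:1907.12308,
arXiv:2307.07619 (RG approach to functional inequalities — no gauge theory); card lookup (iii): nothing printed for any LGT. -/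
theorem stub_fluctuationPoincare :
    ∀ (G : Type) [Group G] [TopologicalSpace G] [IsTopologicalGroup G] [CompactSpace G]
      [MeasurableSpace G] [BorelSpace G], IsCompactSimpleLieGroup G → SimplyConnectedSpace G → ∀ (r : LatticeRep G),
      ∃ (b : ℕ) (_ : NeZero b), 2 ≤ b ∧ ∃ β₁ : ℝ, ∀ β : ℝ, β₁ ≤ β → ∀ (n : ℕ), 1 ≤ n → ∀ (s : ℝ), β ≤ s →
      ∃ γ : ℝ, ∀ (S : ℕ) (P : Measure (GaugeConfig 4 (2 * S + 1) G ×
          ((k : Fin n) → GaugeConfig 4 (BalabanAveraging.blockSide (2 * S + 1) (b ^ ((k : ℕ) + 1))) G))),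
      P = ((wilsonMeasure r.ρ β : Measure (GaugeConfig 4 (2 * S + 1) G)).prod
          (Measure.pi fun k : Fin n => Measure.pi
            fun _ : Edge 4 (BalabanAveraging.blockSide (2 * S + 1) (b ^ ((k : ℕ) + 1))) => haarProbability G)).tilted
          (fun ω => ∑ k : Fin n, ∑ e : Edge 4 (BalabanAveraging.blockSide (2 * S + 1) (b ^ ((k : ℕ) + 1))),
            s * (r.ρ (ω.2 k e * (BalabanAveraging.link (2 * S + 1) (b ^ ((k : ℕ) + 1))
              (BalabanAveraging.BlockMean.rep 0) ω.1 e)⁻¹)).trace.re) →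
      ∀ (T : ℕ → GaugeConfig 4 (2 * S + 1) G ×
          ((k : Fin n) → GaugeConfig 4 (BalabanAveraging.blockSide (2 * S + 1) (b ^ ((k : ℕ) + 1))) G) →
          ((k : Fin n) → GaugeConfig 4 (BalabanAveraging.blockSide (2 * S + 1) (b ^ ((k : ℕ) + 1))) G)),
      (∀ j ω k, T j ω k = if j ≤ (k : ℕ) then ω.2 k else fun _ => 1) →
      ∀ (T' : (k : Fin n) → Edge 4 (BalabanAveraging.blockSide (2 * S + 1) (b ^ ((k : ℕ) + 1))) →
          GaugeConfig 4 (2 * S + 1) G ×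
          ((k : Fin n) → GaugeConfig 4 (BalabanAveraging.blockSide (2 * S + 1) (b ^ ((k : ℕ) + 1))) G) →
          ((k : Fin n) → GaugeConfig 4 (BalabanAveraging.blockSide (2 * S + 1) (b ^ ((k : ℕ) + 1))) G)),
      (∀ k e ω i, T' k e ω i =
        if (k : ℕ) ≤ (i : ℕ) then Function.update ω.2 k (Function.update (ω.2 k) e 1) i else fun _ => 1) →
      ∀ (F : GaugeConfig 4 (2 * S + 1) G → ℝ), Measurable F → (∃ M : ℝ, ∀ U, |F U| ≤ M) →
      (∫ ω, (F ω.1 - condExp (MeasurableSpace.comap (T 0) inferInstance) P (F ∘ Prod.fst) ω) ^ 2 ∂P ≤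
        γ * ∑ ℓ : Edge 4 (2 * S + 1), ∫ U, ∫ g, (F U - F (Function.update U ℓ g)) ^ 2
            ∂((haarProbability G).tilted (fun g' => -β * wilsonAction r.ρ (Function.update U ℓ g')))
            ∂(wilsonMeasure r.ρ β : Measure (GaugeConfig 4 (2 * S + 1) G))) ∧
      (∀ k : Fin n, (k : ℕ) + 1 < n →
        ∫ ω, (condExp (MeasurableSpace.comap (T k) inferInstance) P (F ∘ Prod.fst) ω -
            condExp (MeasurableSpace.comap (T ((k : ℕ) + 1)) inferInstance) P (F ∘ Prod.fst) ω) ^ 2 ∂P ≤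
        γ * ∑ e : Edge 4 (BalabanAveraging.blockSide (2 * S + 1) (b ^ ((k : ℕ) + 1))),
            ∫ ω, (condExp (MeasurableSpace.comap (T k) inferInstance) P (F ∘ Prod.fst) ω -
              condExp (MeasurableSpace.comap (T' k e) inferInstance) P (F ∘ Prod.fst) ω) ^ 2 ∂P) := by
  sorry

/-- `stub_dirichletCascade` — **THE DIRICHLET CASCADE: one level of conditioning costs a bounded factor in the form**
(C; size L; card P2, TRIAGE-r2-1 (2), r2-2 "P2 is the genuinely new estimate", r2-3 (e)).  For compact simple simply-connected
`G`, faithful unitary `r` and EVERY block base `b ≥ 2` there is `β₁ = β₁(G, r, b)` such that for all `β ≥ β₁`, `n ≥ 1`, `s ≥ β`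
there is `κ = κ(G, r, b, β, n, s)` with, for every side and bounded measurable `F` (`F_k = E_P[F∘fst | 𝓖_k]`):
  (base)  `D_0(F) = Σ_e ∫ (F_0 − E_P[f | 𝓖_{0,e}])² dP ≤ κ · HB(F)`;
  (step)  `D_{k+1}(F) ≤ κ · D_k(F)` for consecutive levels `k, k+1 < n`.
MECHANISM.  Resampling ONE coarse link `e` of level `k+1` given everything else at levels `≥ k+1` moves `F_{k+1}` by a
posterior covariance: by Bayes the conditional law of the finer data given the coarse fields changes by the likelihood ratio
`R_e = exp(s Re tr ρ(w h_e⁻¹)) / exp(s Re tr ρ(V_e h_e⁻¹))`, a function of ONE block transporter `h_e`, so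
`F_{k+1}(…V_e…) − F_{k+1}(…w…) = Cov(F_k-type quantity, R_e)/E[R_e]` under the pinned fluctuation law.  This is the
discrete form of the Grunewald–Otto–Villani–Westdickenberg coupling identity `∇_y Pf = P∇_y f + Cov_{μ(·|y)}(f, ∇_y H)`: by
DUALITY (test against `v ∈ ℝ^{E'}`) and Cauchy–Schwarz, `Σ_e Cov(F, R_e)²`-type sums are bounded by `Var(F)` under the pinned
law times `sup_{|v|=1} Var(Σ_e v_e R_e)`, and BOTH factors are turned into Dirichlet forms by a Poincaré inequality OF THE PINNED
LAW (massive by constraint — the regime of stub B, here needed pointwise on most of the pin space, with bounded likelihood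
ratios `R_e ∈ [e^{−2sN}, e^{2sN}]` on the rest; Dobrushin–Shlosman-type smooth dependence inside the small-field region) — no
locality of `F` is required.  Constants: for `F = φ(one coarse datum)` a fine link moves a rep-0 transporter by `O(1)` on `b`
of the `4b⁴` links, so `κ ≍ b²–b⁴` per level and `Π κ ≍ poly(ξ(β))` — the honest diffusive factor (TRIAGE-r1-2 (f2), r2-1,
Disproof §4 "C independent of β refuted").  The base case is the same estimate between the coarse level `0` (pins at scale `b`)
and the fine Wilson heat bath.  NOT implied by UP (a smoothing property of `E[·|𝓖_{k+1}]`, r2-2 (s4)); at each FIXED side the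
ratio is finite (`D ≤ #E'·Var ≤ #E'·C_S·HB` by the tree's `perVolume_heatBathPoincare`), so the content is again uniformity in
`S`; not known to fail anywhere, scoped like B because its proof consumes B's Poincaré inequality for the pinned laws.
Sources: doi:10.1214/07-aihp200 (GOVW two-scale: the covariance coupling term); Lu–Yau doi:10.1007/bf02098489; Yau
doi:10.1007/bf02101009; DobrushinShlosman1987 (complete analyticity / smooth dependence); Balaban1985Averaging (locality (11),
tree `link_dependsOn`). -/
theorem stub_dirichletCascade :
    ∀ (G : Type) [Group G] [TopologicalSpace G] [IsTopologicalGroup G] [CompactSpace G]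
      [MeasurableSpace G] [BorelSpace G], IsCompactSimpleLieGroup G → SimplyConnectedSpace G →
      ∀ (r : LatticeRep G) (b : ℕ) [NeZero b], 2 ≤ b →
      ∃ β₁ : ℝ, ∀ β : ℝ, β₁ ≤ β → ∀ (n : ℕ), 1 ≤ n → ∀ (s : ℝ), β ≤ s →
      ∃ κ : ℝ, ∀ (S : ℕ) (P : Measure (GaugeConfig 4 (2 * S + 1) G ×
          ((k : Fin n) → GaugeConfig 4 (BalabanAveraging.blockSide (2 * S + 1) (b ^ ((k : ℕ) + 1))) G))),
      P = ((wilsonMeasure r.ρ β : Measure (GaugeConfig 4 (2 * S + 1) G)).prod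
          (Measure.pi fun k : Fin n => Measure.pi
            fun _ : Edge 4 (BalabanAveraging.blockSide (2 * S + 1) (b ^ ((k : ℕ) + 1))) => haarProbability G)).tilted
          (fun ω => ∑ k : Fin n, ∑ e : Edge 4 (BalabanAveraging.blockSide (2 * S + 1) (b ^ ((k : ℕ) + 1))),
            s * (r.ρ (ω.2 k e * (BalabanAveraging.link (2 * S + 1) (b ^ ((k : ℕ) + 1))
              (BalabanAveraging.BlockMean.rep 0) ω.1 e)⁻¹)).trace.re) →
      ∀ (T : ℕ → GaugeConfig 4 (2 * S + 1) G ×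
          ((k : Fin n) → GaugeConfig 4 (BalabanAveraging.blockSide (2 * S + 1) (b ^ ((k : ℕ) + 1))) G) →
          ((k : Fin n) → GaugeConfig 4 (BalabanAveraging.blockSide (2 * S + 1) (b ^ ((k : ℕ) + 1))) G)),
      (∀ j ω k, T j ω k = if j ≤ (k : ℕ) then ω.2 k else fun _ => 1) →
      ∀ (T' : (k : Fin n) → Edge 4 (BalabanAveraging.blockSide (2 * S + 1) (b ^ ((k : ℕ) + 1))) →
          GaugeConfig 4 (2 * S + 1) G ×
          ((k : Fin n) → GaugeConfig 4 (BalabanAveraging.blockSide (2 * S + 1) (b ^ ((k : ℕ) + 1))) G) →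
          ((k : Fin n) → GaugeConfig 4 (BalabanAveraging.blockSide (2 * S + 1) (b ^ ((k : ℕ) + 1))) G)),
      (∀ k e ω i, T' k e ω i =
        if (k : ℕ) ≤ (i : ℕ) then Function.update ω.2 k (Function.update (ω.2 k) e 1) i else fun _ => 1) →
      ∀ (F : GaugeConfig 4 (2 * S + 1) G → ℝ), Measurable F → (∃ M : ℝ, ∀ U, |F U| ≤ M) →
      (∀ k : Fin n, (k : ℕ) = 0 →
        ∑ e : Edge 4 (BalabanAveraging.blockSide (2 * S + 1) (b ^ ((k : ℕ) + 1))),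
            ∫ ω, (condExp (MeasurableSpace.comap (T k) inferInstance) P (F ∘ Prod.fst) ω -
              condExp (MeasurableSpace.comap (T' k e) inferInstance) P (F ∘ Prod.fst) ω) ^ 2 ∂P ≤
        κ * ∑ ℓ : Edge 4 (2 * S + 1), ∫ U, ∫ g, (F U - F (Function.update U ℓ g)) ^ 2
            ∂((haarProbability G).tilted (fun g' => -β * wilsonAction r.ρ (Function.update U ℓ g')))
            ∂(wilsonMeasure r.ρ β : Measure (GaugeConfig 4 (2 * S + 1) G))) ∧
      (∀ k k' : Fin n, (k' : ℕ) = (k : ℕ) + 1 →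
        ∑ e : Edge 4 (BalabanAveraging.blockSide (2 * S + 1) (b ^ ((k' : ℕ) + 1))),
            ∫ ω, (condExp (MeasurableSpace.comap (T k') inferInstance) P (F ∘ Prod.fst) ω -
              condExp (MeasurableSpace.comap (T' k' e) inferInstance) P (F ∘ Prod.fst) ω) ^ 2 ∂P ≤
        κ * ∑ e : Edge 4 (BalabanAveraging.blockSide (2 * S + 1) (b ^ ((k : ℕ) + 1))),
            ∫ ω, (condExp (MeasurableSpace.comap (T k) inferInstance) P (F ∘ Prod.fst) ω -
              condExp (MeasurableSpace.comap (T' k e) inferInstance) P (F ∘ Prod.fst) ω) ^ 2 ∂P) := by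
  sorry

/-- `stub_terminalPoincare` — **THE INFRARED INPUT: the terminal effective theory is in the high-temperature regime**
(D; IMPORTED, confinement-grade — the hardest stub, where the crux meets the summit's difficulty; card P3, TRIAGE-r2-1 (3)
"P3 typed as the hypothesis", r2-2 (s2)/(r3), r2-3 (s2)).  For compact simple simply-connected `G`, faithful unitary `r` and
every block base `b ≥ 2` there is `β₂ = β₂(G, r, b)` such that for all `β ≥ β₂`: IF FS(r, β) (the crux's hypothesis; possibly
idle — FS is infrared-BLIND for simple `G`, TRIAGE-r1-2 S2) THEN there are a number of levels `n = n(β) ≥ 1` (intended: the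
first with `bⁿ ≥ M·ξ(β)`, INDEPENDENT of the side), a pin strength `s ≥ β` and `C_T` with, for every side `2S+1` and bounded
measurable `F`:  `Var_P(E_P[F∘fst | 𝓖_{n−1}]) = ∫ (F_{n−1} − ∫F)² dP ≤ C_T · D_{n−1}(F)` — the marginal law of the COARSEST
block field `V^{n−1}` (a gauge theory on the block torus of side `⌈(2S+1)/bⁿ⌉`, gauge-invariant by covariance of `link`,
`link_gaugeTransform`) satisfies a single-link heat-bath Poincaré inequality uniformly in `S`.
WHY PLAUSIBLE / WHAT IT IS.  At scales `≫ ξ(β)` the straight transporters are essentially independent Haar noise (area law,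
open lines decorrelate), the effective action is high-temperature and the Kantorovich–Rubinstein Dobrushin condition holds,
whence the inequality by the tree's ABSTRACT theorem `StrongPinningPoincare.HeatBath.variance_le_of_kr` (the engine of the landed
9446 and of `heatBathPoincare_smallBeta`, p113987: at `β ≤ β₀(r)` already `n = 1`, `b` large does it; `Law(V^{n−1})` has a
positive continuous density w.r.t. product Haar, so it IS a `(pi Haar).tilted V` and KR is STATABLE for it, r2-3 (d)).  This is
"the RG flow at fixed β reaches the high-temperature fixed point at scale `≍ ξ(β) < ∞`" — the lattice mass-gap mechanism in RG
clothing (r2-1 (b), r2-2 (r3)); the line REDUCES the crux to it, it does not shrink it (like route crux 3).  Tori with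
`2S+1 < bⁿ` are not a hole: there `blockSide = 1`, `V^{n−1}` = four smeared Polyakov lines, and the per-S content is absorbed
in `C_T` (finitely many `S`; tree `perVolume_heatBathPoincare`; r2-2 small-tori repair).  WHERE IT IS FALSE (by design, not in
scope): U(1)₄ / SU(2)₅ Coulomb phases (flow to the Gaussian fixed point, never Dobrushin — `Barriers/NonabelianCoulombPhaseD5`,
`AbelianDeconfinementD4` answered BY HYPOTHESIS: d = 4 and π₁ = 0 enter here and only here); centreless `G` (terminal theory
bimodal in the twist — T's territory); bulk first-order points (phase mixture; FS false there, vacuous).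
Sources: Wu2006 (arXiv:math/0611635), Dobrushin1968, OsterwalderSeilerAnnPhys1978 (strong coupling), arXiv:1803.01950 §5
(Chatterjee, open problem), JaffeWitten2000 §6.5, Balaban1988Convergent (CMP 119, effective actions), Dimock arXiv:1712.10029. -/
theorem stub_terminalPoincare :
    ∀ (G : Type) [Group G] [TopologicalSpace G] [IsTopologicalGroup G] [CompactSpace G]
      [MeasurableSpace G] [BorelSpace G], IsCompactSimpleLieGroup G → SimplyConnectedSpace G →
      ∀ (r : LatticeRep G) (b : ℕ) [NeZero b], 2 ≤ b →
      ∃ β₂ : ℝ, ∀ β : ℝ, β₂ ≤ β →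
      (∀ A B : YMSpecies G, ∃ χ : ℝ, ∀ S : ℕ, ∑ x ∈ Literature.Probability.LatticeModels.box 4 S,
        |covariance (fun U => A.F (Literature.MathematicalPhysics.QuantumLattice.torusLift (2 * S + 1) U))
          (fun U => B.F (Literature.MathematicalPhysics.QuantumLattice.configShift (-x)
          (Literature.MathematicalPhysics.QuantumLattice.torusLift (2 * S + 1) U)))
          (wilsonMeasure r.ρ β : Measure (GaugeConfig 4 (2 * S + 1) G))| ≤ χ) →
      ∃ n : ℕ, 1 ≤ n ∧ ∃ s : ℝ, β ≤ s ∧ ∃ C : ℝ, ∀ (S : ℕ) (P : Measure (GaugeConfig 4 (2 * S + 1) G ×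
          ((k : Fin n) → GaugeConfig 4 (BalabanAveraging.blockSide (2 * S + 1) (b ^ ((k : ℕ) + 1))) G))),
      P = ((wilsonMeasure r.ρ β : Measure (GaugeConfig 4 (2 * S + 1) G)).prod
          (Measure.pi fun k : Fin n => Measure.pi
            fun _ : Edge 4 (BalabanAveraging.blockSide (2 * S + 1) (b ^ ((k : ℕ) + 1))) => haarProbability G)).tilted
          (fun ω => ∑ k : Fin n, ∑ e : Edge 4 (BalabanAveraging.blockSide (2 * S + 1) (b ^ ((k : ℕ) + 1))),
            s * (r.ρ (ω.2 k e * (BalabanAveraging.link (2 * S + 1) (b ^ ((k : ℕ) + 1))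
              (BalabanAveraging.BlockMean.rep 0) ω.1 e)⁻¹)).trace.re) →
      ∀ (T : ℕ → GaugeConfig 4 (2 * S + 1) G ×
          ((k : Fin n) → GaugeConfig 4 (BalabanAveraging.blockSide (2 * S + 1) (b ^ ((k : ℕ) + 1))) G) →
          ((k : Fin n) → GaugeConfig 4 (BalabanAveraging.blockSide (2 * S + 1) (b ^ ((k : ℕ) + 1))) G)),
      (∀ j ω k, T j ω k = if j ≤ (k : ℕ) then ω.2 k else fun _ => 1) →
      ∀ (T' : (k : Fin n) → Edge 4 (BalabanAveraging.blockSide (2 * S + 1) (b ^ ((k : ℕ) + 1))) →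
          GaugeConfig 4 (2 * S + 1) G ×
          ((k : Fin n) → GaugeConfig 4 (BalabanAveraging.blockSide (2 * S + 1) (b ^ ((k : ℕ) + 1))) G) →
          ((k : Fin n) → GaugeConfig 4 (BalabanAveraging.blockSide (2 * S + 1) (b ^ ((k : ℕ) + 1))) G)),
      (∀ k e ω i, T' k e ω i =
        if (k : ℕ) ≤ (i : ℕ) then Function.update ω.2 k (Function.update (ω.2 k) e 1) i else fun _ => 1) →
      ∀ (F : GaugeConfig 4 (2 * S + 1) G → ℝ), Measurable F → (∃ M : ℝ, ∀ U, |F U| ≤ M) →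
      ∀ k : Fin n, (k : ℕ) + 1 = n →
        ∫ ω, (condExp (MeasurableSpace.comap (T k) inferInstance) P (F ∘ Prod.fst) ω -
            condExp (MeasurableSpace.comap (T ((k : ℕ) + 1)) inferInstance) P (F ∘ Prod.fst) ω) ^ 2 ∂P ≤
        C * ∑ e : Edge 4 (BalabanAveraging.blockSide (2 * S + 1) (b ^ ((k : ℕ) + 1))),
            ∫ ω, (condExp (MeasurableSpace.comap (T k) inferInstance) P (F ∘ Prod.fst) ω -
              condExp (MeasurableSpace.comap (T' k e) inferInstance) P (F ∘ Prod.fst) ω) ^ 2 ∂P := by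
  sorry

/-- `stub_typedDeclResidual` — **SCOPE SENTINEL: "the typed decl follows from its weak-coupling simply-connected core"**
(T; REFUTED MODULO THE STANDING INPUTS — NOT TO BE STAFFED; registered only because the crux is concluded BY NAME as typed).
For every compact simple `G` and `r`: if (whenever `G` is simply connected) FS ⇒ UP holds above some threshold `β⋆(G, r)`,
then FS ⇒ UP holds for ALL `β ≥ 0`.  Content: (i) for centreless `G` the hypothesis is vacuous and the statement is 4b
(`∀ β ≥ 0, FS → UP`), refuted modulo the 't Hooft twist-sector inputs H of SO(3)₄ (`typedDeclResidual_false_of_twistInputs_centreless`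
below, H written out verbatim; cf. the landed p76563, not imported); (ii) for simply-connected `G` it is the EXTENSION of the weak-coupling implication down to
`β = 0`, whose only content is the window `(β₀(r), β⋆)` (`heatBathPoincare_smallBeta`, p113987) — refuted modulo
(`SimplyConnectedSpace SU(2)` ∧ the Bhanot–Creutz twist inputs hW ∧ C″ at SU(2)) by the landed p77766 bottleneck
(`typedDeclResidual_false_of_twistInputsSU2` below).  Both refutations are conditional on open confinement-grade inputs, so the
statement is not refuted in the ledger sense (NEGATIVE LEMMA HOLDS rule), exactly like the crux itself — it is the typed decl
minus its open core, nothing more.  Under restatement (A) = C″ this stub is deleted and `core_of` is the composition; under the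
hybrid (B)+`UPWeakCouplingSC` (TRIAGE-r2-2 N2) likewise.  Sources: arXiv:0911.1721, BhanotCreutz1981, Thooft1979,
DeforcrandJahn2003 (the witnesses); Disproof.lean §§2–5. -/
theorem stub_typedDeclResidual :
    ∀ (G : Type) [Group G] [TopologicalSpace G] [IsTopologicalGroup G] [CompactSpace G]
      [MeasurableSpace G] [BorelSpace G], IsCompactSimpleLieGroup G → ∀ (r : LatticeRep G),
      (SimplyConnectedSpace G → ∃ β₁ : ℝ, ∀ β : ℝ, β₁ ≤ β →
      (∀ A B : YMSpecies G, ∃ χ : ℝ, ∀ S : ℕ, ∑ x ∈ Literature.Probability.LatticeModels.box 4 S,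
        |covariance (fun U => A.F (Literature.MathematicalPhysics.QuantumLattice.torusLift (2 * S + 1) U))
          (fun U => B.F (Literature.MathematicalPhysics.QuantumLattice.configShift (-x)
          (Literature.MathematicalPhysics.QuantumLattice.torusLift (2 * S + 1) U)))
          (wilsonMeasure r.ρ β : Measure (GaugeConfig 4 (2 * S + 1) G))| ≤ χ) →
      (∃ C : ℝ, ∀ S : ℕ, ∀ F : GaugeConfig 4 (2 * S + 1) G → ℝ, Measurable F → (∃ M : ℝ, ∀ U, |F U| ≤ M) →
        variance F (wilsonMeasure r.ρ β : Measure (GaugeConfig 4 (2 * S + 1) G)) ≤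
          C * ∑ ℓ : Edge 4 (2 * S + 1), ∫ U, ∫ g, (F U - F (Function.update U ℓ g)) ^ 2
            ∂((haarProbability G).tilted (fun g' => -β * wilsonAction r.ρ (Function.update U ℓ g')))
            ∂(wilsonMeasure r.ρ β : Measure (GaugeConfig 4 (2 * S + 1) G)))) →
      ∀ β : ℝ, 0 ≤ β →
      (∀ A B : YMSpecies G, ∃ χ : ℝ, ∀ S : ℕ, ∑ x ∈ Literature.Probability.LatticeModels.box 4 S,
        |covariance (fun U => A.F (Literature.MathematicalPhysics.QuantumLattice.torusLift (2 * S + 1) U))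
          (fun U => B.F (Literature.MathematicalPhysics.QuantumLattice.configShift (-x)
          (Literature.MathematicalPhysics.QuantumLattice.torusLift (2 * S + 1) U)))
          (wilsonMeasure r.ρ β : Measure (GaugeConfig 4 (2 * S + 1) G))| ≤ χ) →
      (∃ C : ℝ, ∀ S : ℕ, ∀ F : GaugeConfig 4 (2 * S + 1) G → ℝ, Measurable F → (∃ M : ℝ, ∀ U, |F U| ≤ M) →
        variance F (wilsonMeasure r.ρ β : Measure (GaugeConfig 4 (2 * S + 1) G)) ≤
          C * ∑ ℓ : Edge 4 (2 * S + 1), ∫ U, ∫ g, (F U - F (Function.update U ℓ g)) ^ 2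
            ∂((haarProbability G).tilted (fun g' => -β * wilsonAction r.ρ (Function.update U ℓ g')))
            ∂(wilsonMeasure r.ρ β : Measure (GaugeConfig 4 (2 * S + 1) G))) := by
  sorry

/-! ### §3 The kernel-checked composition (sorry-free) -/

/-- **Real arithmetic of the cascade**: the martingale identity, the fluctuation bounds, the Dirichlet cascade and the
terminal bound give `Var ≤ (γ⁺ + max(γ, C_T)⁺ · Σ_{k<n} (κ⁺)^(k+1)) · HB` — all S-dependence sits in `V, a, A, D, H`,
none in the constant. -/
theorem cascade_arith {n : ℕ} {V a H γ κ CT : ℝ} {A D : Fin n → ℝ}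
    (hH : 0 ≤ H) (hD0 : ∀ k, 0 ≤ D k)
    (hV : V = a + ∑ k, A k) (ha : a ≤ γ * H)
    (hAl : ∀ k : Fin n, (k : ℕ) + 1 < n → A k ≤ γ * D k)
    (hAt : ∀ k : Fin n, (k : ℕ) + 1 = n → A k ≤ CT * D k)
    (hDb : ∀ k : Fin n, (k : ℕ) = 0 → D k ≤ κ * H)
    (hDs : ∀ k k' : Fin n, (k' : ℕ) = (k : ℕ) + 1 → D k' ≤ κ * D k) :
    V ≤ (max γ 0 + max (max γ CT) 0 * ∑ k : Fin n, (max κ 0) ^ ((k : ℕ) + 1)) * H := by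
  set mκ : ℝ := max κ 0 with hmκ_def
  set M' : ℝ := max (max γ CT) 0 with hM'_def
  have hmκ0 : 0 ≤ mκ := le_max_right _ _
  have hM'0 : 0 ≤ M' := le_max_right _ _
  have hκle : κ ≤ mκ := le_max_left _ _
  -- the Dirichlet cascade: `D k ≤ mκ^(k+1) H`
  have hDk : ∀ (i : ℕ) (hi : i < n), D ⟨i, hi⟩ ≤ mκ ^ (i + 1) * H := by
    intro i
    induction i with
    | zero =>
      intro hi
      calc D ⟨0, hi⟩ ≤ κ * H := hDb _ rfl
        _ ≤ mκ * H := mul_le_mul_of_nonneg_right hκle hH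
        _ = mκ ^ (0 + 1) * H := by ring
    | succ i ih =>
      intro hi
      have hi' : i < n := Nat.lt_of_succ_lt hi
      calc D ⟨i + 1, hi⟩ ≤ κ * D ⟨i, hi'⟩ := hDs ⟨i, hi'⟩ ⟨i + 1, hi⟩ rfl
        _ ≤ mκ * D ⟨i, hi'⟩ := mul_le_mul_of_nonneg_right hκle (hD0 _)
        _ ≤ mκ * (mκ ^ (i + 1) * H) := mul_le_mul_of_nonneg_left (ih hi') hmκ0
        _ = mκ ^ (i + 1 + 1) * H := by ring
  -- every increment: `A k ≤ M' mκ^(k+1) H`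
  have hAk : ∀ k : Fin n, A k ≤ M' * (mκ ^ ((k : ℕ) + 1) * H) := by
    intro k
    have hDk' : D k ≤ mκ ^ ((k : ℕ) + 1) * H := hDk k k.isLt
    rcases Nat.lt_or_ge ((k : ℕ) + 1) n with hlt | hge
    · calc A k ≤ γ * D k := hAl k hlt
        _ ≤ M' * D k := mul_le_mul_of_nonneg_right ((le_max_left _ _).trans (le_max_left _ _)) (hD0 k)
        _ ≤ M' * (mκ ^ ((k : ℕ) + 1) * H) := mul_le_mul_of_nonneg_left hDk' hM'0
    · have heq : (k : ℕ) + 1 = n := le_antisymm k.isLt hge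
      calc A k ≤ CT * D k := hAt k heq
        _ ≤ M' * D k := mul_le_mul_of_nonneg_right ((le_max_right _ _).trans (le_max_left _ _)) (hD0 k)
        _ ≤ M' * (mκ ^ ((k : ℕ) + 1) * H) := mul_le_mul_of_nonneg_left hDk' hM'0
  have hsum : ∑ k, A k ≤ ∑ k : Fin n, M' * (mκ ^ ((k : ℕ) + 1) * H) :=
    Finset.sum_le_sum fun k _ => hAk k
  have hsum' : ∑ k : Fin n, M' * (mκ ^ ((k : ℕ) + 1) * H) = M' * (∑ k : Fin n, mκ ^ ((k : ℕ) + 1)) * H := by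
    calc ∑ k : Fin n, M' * (mκ ^ ((k : ℕ) + 1) * H) = ∑ k : Fin n, (M' * H) * mκ ^ ((k : ℕ) + 1) :=
          Finset.sum_congr rfl fun k _ => by ring
      _ = (M' * H) * ∑ k : Fin n, mκ ^ ((k : ℕ) + 1) := by rw [Finset.mul_sum]
      _ = M' * (∑ k : Fin n, mκ ^ ((k : ℕ) + 1)) * H := by ring
  have ha' : a ≤ max γ 0 * H := ha.trans (mul_le_mul_of_nonneg_right (le_max_left _ _) hH)
  calc V = a + ∑ k, A k := hV
    _ ≤ max γ 0 * H + M' * (∑ k : Fin n, mκ ^ ((k : ℕ) + 1)) * H :=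
        add_le_add ha' (hsum.trans (le_of_eq hsum'))
    _ = (max γ 0 + M' * ∑ k : Fin n, mκ ^ ((k : ℕ) + 1)) * H := by ring

/-- **A1 + A2 + A3 ⟹ A** (lead's reshape v2, sorry-free glue): the fine marginal of `P` is `μ` (A1), so
`Var_μ F = Var_P (F ∘ fst) = ∫ (F∘fst − ∫ F∘fst dP)² dP` (`variance_map`, `variance_eq_integral`); the abstract
reverse-martingale identity (A2) applied to the comap-filtration of the truncation maps (A3) is the cascade. -/
theorem varianceCascade_of (h1 : JointMarginal) (h2 : ReverseMartingaleVariance) (h3 : TruncFiltration) :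
    VarianceCascade := by
  intro G _ _ _ _ _ _ r β b _ n s S P hP T hT F hF hM
  obtain ⟨hprob, hmap⟩ := h1 G r β b n s S P hP
  obtain ⟨hle, hmono, hbot⟩ := h3 G S b n T hT
  obtain ⟨M, hM'⟩ := hM
  haveI := hprob
  have hv : variance F (wilsonMeasure r.ρ β : Measure (GaugeConfig 4 (2 * S + 1) G)) =
      ∫ ω, ((F ∘ Prod.fst) ω - ∫ ω', (F ∘ Prod.fst) ω' ∂P) ^ 2 ∂P := by
    rw [← hmap, variance_map hF.aemeasurable measurable_fst.aemeasurable,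
      variance_eq_integral (hF.comp measurable_fst).aemeasurable]
  rw [hv]
  exact h2 _ P n (fun j => MeasurableSpace.comap (T j) inferInstance) hle hmono hbot (F ∘ Prod.fst)
    (hF.comp measurable_fst) ⟨M, fun ω => hM' ω.1⟩

/-- **A–D ⟹ C″** (the restatement-ready composition; pointwise in `(G, r)`): B picks the block base, C and D their
thresholds at that base, D the number of levels and the pin strength at `β`, B and C the constants; `stub_varianceCascade`
splits the variance, `cascade_arith` sums the bounds; the constant depends on `(G, r, b, β, n(β), s(β))` only. -/
theorem core_of (hA : VarianceCascade) (hB : FluctuationPoincare) (hC : DirichletCascade)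
    (hD : TerminalPoincare) : CoreSC := by
  intro G _ _ _ _ _ _ hG hSC r
  obtain ⟨b, hbI, hb2, β₁, hB'⟩ := hB G hG hSC r
  obtain ⟨β₁', hC'⟩ := hC G hG hSC r b hb2
  obtain ⟨β₂, hD'⟩ := hD G hG hSC r b hb2
  refine ⟨max β₁ (max β₁' β₂), fun β hβ hFS => ?_⟩
  have hβ₁ : β₁ ≤ β := le_trans (le_max_left _ _) hβ
  have hβ₁' : β₁' ≤ β := le_trans ((le_max_left _ _).trans (le_max_right _ _)) hβ
  have hβ₂ : β₂ ≤ β := le_trans ((le_max_right _ _).trans (le_max_right _ _)) hβ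
  obtain ⟨n, hn, s, hs, CT, hT⟩ := hD' β hβ₂ hFS
  obtain ⟨γ, hγ⟩ := hB' β hβ₁ n hn s hs
  obtain ⟨κ, hκ⟩ := hC' β hβ₁' n hn s hs
  refine ⟨max γ 0 + max (max γ CT) 0 * ∑ k : Fin n, (max κ 0) ^ ((k : ℕ) + 1), fun S F hF hM => ?_⟩
  have eA := hA G r β b n s S _ rfl _ (fun _ _ _ => rfl) F hF hM
  obtain ⟨hBf, hBl⟩ := hγ S _ rfl _ (fun _ _ _ => rfl) _ (fun _ _ _ _ => rfl) F hF hM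
  obtain ⟨hCb, hCs⟩ := hκ S _ rfl _ (fun _ _ _ => rfl) _ (fun _ _ _ _ => rfl) F hF hM
  have hDt := hT S _ rfl _ (fun _ _ _ => rfl) _ (fun _ _ _ _ => rfl) F hF hM
  exact cascade_arith (HB_nonneg r β F) (fun k => dLev_nonneg _ _ _ k F) eA hBf hBl hDt hCb hCs

/-- **C″ + the sentinel ⟹ the crux unfolded.** -/
theorem crux_unfolded_of (hcore : CoreSC) (hT : TypedDeclResidual) :
    ∀ (G : Type) [Group G] [TopologicalSpace G] [IsTopologicalGroup G] [CompactSpace G]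
      [MeasurableSpace G] [BorelSpace G], IsCompactSimpleLieGroup G →
      ∀ (r : LatticeRep G) (β : ℝ), 0 ≤ β → FS r β → UP r β :=
  fun G _ _ _ _ _ _ hG r β hβ hFS => hT G hG r (fun hSC => hcore G hG hSC r) β hβ hFS

/-- **The restated crux C″ from the registered stubs A–D** (transfers verbatim once the tenure planner restates; its only
non-whitelisted axiom is the `sorryAx` of the stubs). -/
theorem coreSC_of_stubs : CoreSC :=
  core_of (varianceCascade_of stub_jointMarginal stub_reverseMartingaleVariance stub_truncFiltration)
    stub_fluctuationPoincare stub_dirichletCascade stub_terminalPoincare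

/-- **The skeleton theorem**: the crux BY NAME from the five registered stubs (its only non-whitelisted axiom is the
`sorryAx` of the stubs; `core_of`, `crux_unfolded_of`, `cascade_arith` are the sorry-free logic). -/
theorem SusceptibilityToPoincare_of :
    Summit.QuantumFields.YangMills.Theses.FradkinShenkerFlow.SusceptibilityToPoincare :=
  crux_iff.2 (crux_unfolded_of coreSC_of_stubs stub_typedDeclResidual)

/-! ### §4 Kernel-checked honesty about the sentinel (sorry-free): T is exactly what the standing inputs refute -/

/-- **T is false modulo the 't Hooft twist-sector inputs H** (centreless half: T's hypothesis is vacuous there, so T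
restricts to 4b, `∀ β ≥ 0, FS → UP` for a centreless compact simple `G`, and a twist-sector bottleneck — events of mass in
`[δ, 1−δ]` with vanishing heat-bath boundary flux along `S → ∞` — kills every uniform heat-bath Poincaré constant by the landed
`Negative.not_uniformHeatBathPoincare_of_bottleneck`).  H is written out VERBATIM (it is the body of the registered open
Literature statement of the twist-sector inputs, p76562, deliberately NOT imported or named here: route-choice
rchoice-…-8bac143f). [folklore] -/
theorem typedDeclResidual_false_of_twistInputs_centreless
    (h : ∃ (G : Type) (_ : Group G) (_ : TopologicalSpace G) (_ : IsTopologicalGroup G) (_ : CompactSpace G)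
      (_ : MeasurableSpace G) (_ : BorelSpace G),
      IsCompactSimpleLieGroup G ∧ ¬ SimplyConnectedSpace G ∧
      ∃ (r : LatticeRep G) (β : ℝ), 0 ≤ β ∧
      (∀ A B : YMSpecies G, ∃ χ : ℝ, ∀ S : ℕ, ∑ x ∈ Literature.Probability.LatticeModels.box 4 S,
        |covariance (fun U => A.F (Literature.MathematicalPhysics.QuantumLattice.torusLift (2 * S + 1) U))
          (fun U => B.F (Literature.MathematicalPhysics.QuantumLattice.configShift (-x)
              (Literature.MathematicalPhysics.QuantumLattice.torusLift (2 * S + 1) U)))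
          (wilsonMeasure (d := 4) (L := 2 * S + 1) r.ρ β)| ≤ χ) ∧
      ∃ δ : ℝ, 0 < δ ∧ ∃ A : ∀ S : ℕ, Set (GaugeConfig 4 (2 * S + 1) G),
        (∀ S, MeasurableSet (A S)) ∧
        (∀ S, IsGaugeInvariant ((A S).indicator (1 : GaugeConfig 4 (2 * S + 1) G → ℝ))) ∧
        (∀ S, δ ≤ (wilsonMeasure (d := 4) (L := 2 * S + 1) r.ρ β).real (A S) ∧
          (wilsonMeasure (d := 4) (L := 2 * S + 1) r.ρ β).real (A S) ≤ 1 - δ) ∧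
        Tendsto (fun S : ℕ => ∑ ℓ : Edge 4 (2 * S + 1), ∫ U, ∫ g,
            ((A S).indicator (1 : GaugeConfig 4 (2 * S + 1) G → ℝ) U -
              (A S).indicator 1 (Function.update U ℓ g)) ^ 2
          ∂((haarProbability G).tilted (fun g' => -β * wilsonAction r.ρ (Function.update U ℓ g')))
          ∂(wilsonMeasure (d := 4) (L := 2 * S + 1) r.ρ β)) atTop (𝓝 0)) :
    ¬ TypedDeclResidual := by
  intro hT
  obtain ⟨G, _, _, _, _, _, _, hG, hnsc, r, β, hβ, hFS, δ, hδ, A, hmeas, -, hmass, hflux⟩ := h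
  exact Summit.QuantumFields.YangMills.Theorems.SusceptibilityToPoincare.Negative.not_uniformHeatBathPoincare_of_bottleneck
    r β hδ A hmeas hmass hflux (hT G hG r (fun hsc => absurd hsc hnsc) β hβ hFS)

/-- **T is false modulo (the Bhanot–Creutz twist inputs hW ∧ C″ at SU(2))** (simply-connected half: with C″ supplied for
SU(2) — believed TRUE, it is the open core — T yields FS ⇒ UP at EVERY `β ≥ 0`, in particular at the phase-II witness `(r, β)`
of p77766, where the gauge-invariant twist sectors form a bottleneck — `Negative.not_invariantHeatBathPoincare_of_invariantBottleneck`;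
no `SimplyConnectedSpace SU(2)` input is even needed, T's hypothesis being discharged by C″ itself).  `hW` is restated verbatim
from `Negative/TwistSectorSimplyConnected.lean`. [folklore] -/
theorem typedDeclResidual_false_of_twistInputsSU2
    (hW : ∃ (r : LatticeRep (Matrix.specialUnitaryGroup (Fin 2) ℂ)) (β : ℝ), 0 ≤ β ∧
      (∀ A B : YMSpecies (Matrix.specialUnitaryGroup (Fin 2) ℂ), ∃ χ : ℝ, ∀ S : ℕ,
        ∑ x ∈ Literature.Probability.LatticeModels.box 4 S,
        |covariance (fun U => A.F (Literature.MathematicalPhysics.QuantumLattice.torusLift (2 * S + 1) U))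
          (fun U => B.F (Literature.MathematicalPhysics.QuantumLattice.configShift (-x)
          (Literature.MathematicalPhysics.QuantumLattice.torusLift (2 * S + 1) U)))
          (wilsonMeasure (d := 4) (L := 2 * S + 1) r.ρ β)| ≤ χ) ∧
      ∃ δ : ℝ, 0 < δ ∧ ∃ A : (∀ S : ℕ, Set (GaugeConfig 4 (2 * S + 1) (Matrix.specialUnitaryGroup (Fin 2) ℂ))),
        (∀ S, MeasurableSet (A S)) ∧
        (∀ S, IsGaugeInvariant ((A S).indicator
          (1 : GaugeConfig 4 (2 * S + 1) (Matrix.specialUnitaryGroup (Fin 2) ℂ) → ℝ))) ∧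
        (∀ S, δ ≤ (wilsonMeasure (d := 4) (L := 2 * S + 1) r.ρ β).real (A S) ∧
          (wilsonMeasure (d := 4) (L := 2 * S + 1) r.ρ β).real (A S) ≤ 1 - δ) ∧
        Tendsto (fun S : ℕ => ∑ ℓ : Edge 4 (2 * S + 1), ∫ U, ∫ g,
            ((A S).indicator (1 : GaugeConfig 4 (2 * S + 1) (Matrix.specialUnitaryGroup (Fin 2) ℂ) → ℝ) U -
              (A S).indicator 1 (Function.update U ℓ g)) ^ 2
          ∂((haarProbability (Matrix.specialUnitaryGroup (Fin 2) ℂ)).tilted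
              (fun g' => -β * wilsonAction r.ρ (Function.update U ℓ g')))
          ∂(wilsonMeasure (d := 4) (L := 2 * S + 1) r.ρ β)) atTop (𝓝 0))
    (hcore : ∀ r : LatticeRep (Matrix.specialUnitaryGroup (Fin 2) ℂ), ∃ β₁ : ℝ, ∀ β : ℝ, β₁ ≤ β → FS r β → UP r β) :
    ¬ TypedDeclResidual := by
  intro hT
  obtain ⟨r, β, hβ, hFS, δ, hδ, A, hmeas, hinv, hmass, hflux⟩ := hW
  obtain ⟨C, hC⟩ := hT (Matrix.specialUnitaryGroup (Fin 2) ℂ)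
    Summit.QuantumFields.YangMills.Theorems.SusceptibilityToPoincare.Negative.isCompactSimpleLieGroup_su2 r
    (fun _ => hcore r) β hβ hFS
  exact Summit.QuantumFields.YangMills.Theorems.SusceptibilityToPoincare.Negative.not_invariantHeatBathPoincare_of_invariantBottleneck
    r β hδ A hmeas hinv hmass hflux ⟨C, fun S F hF hM _ => hC S F hF hM⟩

/-! ### §5 Kernel-checked tightness (lead c3, cycle 2; sorry-free): D and B-fine are CONSEQUENCES of the goal

The necessity package (`Theorems/…TerminalNecessity.lean`, `…OneLevelNecessity.lean` and the riders N1–N5, G1b):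
UP for `μ_{β,S}` implies stub D's terminal inequality and stub B's fine clause, S-uniformly.  Hence the restated crux
C″ (`CoreSC`) implies `TerminalPoincare` — D is exactly as strong, on the terminal observables, as the conclusion it
serves; it cannot be refuted inside C″'s scope without refuting C″, and promoting it to an item loses nothing.  NOT
implied (by design): B's level clauses and C — the Poincaré / smoothing content of the PINNED (fluctuation) measures. -/

/-- **C″ ⟹ D**: the restated crux implies the statement of stub D verbatim
(`coreSC_imp_terminalPoincare` of the necessity package: `β₂ := β₁`, `n := 1`, `s := β`). [folklore] -/
theorem terminalPoincare_of_coreSC (hcore : CoreSC) : TerminalPoincare :=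
  Summit.QuantumFields.YangMills.Theorems.SusceptibilityToPoincare.RgVarianceCascade.coreSC_imp_terminalPoincare
    (fun G _ _ _ _ _ _ hG hsc r => hcore G hG hsc r)

/-- **UP ⟹ B-fine**: the uniform heat-bath Poincaré inequality with constant `C` implies the fine clause of stub B
with `γ := C`, for every `b, n, s, S` (`fineClause_of_up` of the necessity package). [folklore] -/
theorem aFine_le_of_up {G : Type} [Group G] [TopologicalSpace G] [IsTopologicalGroup G] [CompactSpace G]
    [MeasurableSpace G] [BorelSpace G] (r : LatticeRep G) (β C : ℝ)
    (hUP : ∀ (S : ℕ) (F : GaugeConfig 4 (2 * S + 1) G → ℝ), Measurable F → (∃ M : ℝ, ∀ U, |F U| ≤ M) →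
      variance F (wilsonMeasure r.ρ β : Measure (GaugeConfig 4 (2 * S + 1) G)) ≤ C * HB r β S F)
    (b : ℕ) [NeZero b] (n : ℕ) (s : ℝ) (S : ℕ) (P : Measure (CSpace G S b n)) (hP : P = jointMeasure r β S b n s)
    (T : ℕ → CSpace G S b n → CoarseAll G S b n) (hT : ∀ j ω k, T j ω k = trunc S b n j ω k)
    (F : GaugeConfig 4 (2 * S + 1) G → ℝ) (hF : Measurable F) (hFb : ∃ M : ℝ, ∀ U, |F U| ≤ M) :
    aFine P T F ≤ C * HB r β S F :=
  Summit.QuantumFields.YangMills.Theorems.SusceptibilityToPoincare.RgVarianceCascade.fineClause_of_up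
    G r β C hUP b n s S P hP T hT F hF hFb


/-! ### §6 Restatement package (lead c4, cycle 3; sorry-free): the typed decl is `CoreSC ∧ T`; the route closes from
`CoreSC` plus a centreless clustering companion

Eight lead seats, drefute, cdisprove, both round-2 ideators and all round-2 triagers concur: the decl AS TYPED is refuted modulo
the standing twist inputs on both sides of the `π₁` cut and every line reduces it to the same residual; the buildable content is
C″ = `CoreSC`.  This section is the kernel-checked form of that verdict and of the repair, in the vocabulary of the route file:
* `crux_iff_coreSC_and_residual` — `SusceptibilityToPoincare ↔ CoreSC ∧ TypedDeclResidual`: restating 9441 as C″ deletes EXACTLY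
  the sentinel T (refuted modulo inputs, §4), nothing else;
* `NonSimplyConnectedClustering` (N) — the companion statement for centreless `G` in the CLUSTERING currency (the heat-bath
  Poincaré currency is the one the twist sectors kill; exponential clustering of local gauge-invariant observables is immune to
  them, TRIAGE-r2-1/r2-3): `IsCompactSimpleLieGroup G → ¬ SimplyConnectedSpace G → ∀ r, ∃ β₁, ∀ β ≥ β₁, FS r β → EC r β`; it is
  IMPLIED by the typed decl together with the proved item 9444 (`nonSimplyConnectedClustering_of_crux`), so (C″, N) is a pure
  weakening of (9441, 9444) — cf. the ConvexGribovBody repair `BrascampLiebVacuumSC` (stmt-16404) + `NonSimplyConnectedLatticeGap`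
  (stmt-16405, which asserts EC outright, without the FS hypothesis);
* `closes_restated` — `CoreSC → N → PoincareToClustering → FiniteSusceptibilityWeakCoupling → ClusteringToYangMills → YangMills`:
  the route's deciding theorem with 9441 replaced by the pair (C″, N) (`by_cases SimplyConnectedSpace G`; thresholds absorbed by
  `max`), i.e. the restated route is closed by the same four other items;
* `yangMills_of_stubs` — the restated route from the registered stubs A–D (via `coreSC_of_stubs`), N and the three other items:
  this skeleton IS the restated crux's line, with sorries exactly B, C, D (T is not used). -/

section RestatementVocabulary

variable {G : Type} [Group G] [TopologicalSpace G] [IsTopologicalGroup G] [CompactSpace G]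
  [MeasurableSpace G] [BorelSpace G]

/-- EC(r, β): exponential clustering in Euclidean time of every pair of bounded gauge-invariant local observables,
uniformly in the volume — verbatim the conclusion of `PoincareToClustering` (item 9444, proved) and the clause consumed by
`ClusteringToYangMills` (item 9443). -/
def EC (r : LatticeRep G) (β : ℝ) : Prop :=
  ∃ m : ℝ, 0 < m ∧ ∀ A B : YMSpecies G, ∃ C : ℝ, ∀ S n : ℕ, n ≤ S →
    |latticeConnectedCorr r.ρ β (2 * S + 1) A.F B.F n| ≤ C * Real.exp (-(m * n))

end RestatementVocabulary

/-- Item 9444 re-read through `UP`/`EC` (definitional). -/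
theorem poincareToClustering_iff :
    Summit.QuantumFields.YangMills.Theses.FradkinShenkerFlow.PoincareToClustering ↔
      ∀ (G : Type) [Group G] [TopologicalSpace G] [IsTopologicalGroup G] [CompactSpace G]
        [MeasurableSpace G] [BorelSpace G] (r : LatticeRep G) (β : ℝ), 0 ≤ β → UP r β → EC r β :=
  Iff.rfl

/-- Item 9442 re-read through `FS` (definitional). -/
theorem finiteSusceptibilityWeakCoupling_iff :
    Summit.QuantumFields.YangMills.Theses.FradkinShenkerFlow.FiniteSusceptibilityWeakCoupling ↔
      ∀ (G : Type) [Group G] [TopologicalSpace G] [IsTopologicalGroup G] [CompactSpace G]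
        [MeasurableSpace G] [BorelSpace G], IsCompactSimpleLieGroup G →
        ∀ (r : LatticeRep G), ∃ β₀ : ℝ, ∀ β : ℝ, β₀ ≤ β → FS r β :=
  Iff.rfl

/-- Item 9443 re-read through `EC` (definitional). -/
theorem clusteringToYangMills_iff :
    Summit.QuantumFields.YangMills.Theses.FradkinShenkerFlow.ClusteringToYangMills ↔
      ((∀ (G : Type) [Group G] [TopologicalSpace G] [IsTopologicalGroup G] [CompactSpace G]
        [MeasurableSpace G] [BorelSpace G], IsCompactSimpleLieGroup G →
        ∀ (r : LatticeRep G), ∃ β₀ : ℝ, ∀ β : ℝ, β₀ ≤ β → EC r β) → YangMills) :=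
  Iff.rfl

/-- **N — the centreless companion of C″** (restatement proposal; the currency for `π₁(G) ≠ 0` is clustering, not the
heat-bath Poincaré inequality): for every compact simple NON-simply-connected `G` and faithful unitary `r` there is `β₁`
such that FS(r, β) ⇒ EC(r, β) for all `β ≥ β₁`.  Dropping the hypothesis FS gives the shape of ConvexGribovBody's
`NonSimplyConnectedLatticeGap` (stmt-16405). -/
def NonSimplyConnectedClustering : Prop :=
  ∀ (G : Type) [Group G] [TopologicalSpace G] [IsTopologicalGroup G] [CompactSpace G]
    [MeasurableSpace G] [BorelSpace G], IsCompactSimpleLieGroup G → ¬ SimplyConnectedSpace G →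
    ∀ (r : LatticeRep G), ∃ β₁ : ℝ, ∀ β : ℝ, β₁ ≤ β → FS r β → EC r β

/-- **The typed decl implies its restated core C″** (`β₁ := 0`). -/
theorem coreSC_of_crux
    (h : Summit.QuantumFields.YangMills.Theses.FradkinShenkerFlow.SusceptibilityToPoincare) : CoreSC :=
  fun G _ _ _ _ _ _ hG _ r => ⟨0, fun β hβ hFS => crux_iff.1 h G hG r β hβ hFS⟩

/-- **The typed decl implies its sentinel T** (T's conclusion is the decl's body). -/
theorem typedDeclResidual_of_crux
    (h : Summit.QuantumFields.YangMills.Theses.FradkinShenkerFlow.SusceptibilityToPoincare) : TypedDeclResidual :=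
  fun G _ _ _ _ _ _ hG r _ β hβ hFS => crux_iff.1 h G hG r β hβ hFS

/-- **9441 AS TYPED = C″ ∧ T.**  Restating the crux as `CoreSC` removes exactly the sentinel `TypedDeclResidual`, which
§4 refutes modulo the standing twist inputs on both sides of the `π₁` cut; every landed support of every line is a statement
about `(G, r, β)` pointwise and transfers verbatim. -/
theorem crux_iff_coreSC_and_residual :
    Summit.QuantumFields.YangMills.Theses.FradkinShenkerFlow.SusceptibilityToPoincare ↔
      (CoreSC ∧ TypedDeclResidual) :=
  ⟨fun h => ⟨coreSC_of_crux h, typedDeclResidual_of_crux h⟩,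
    fun h => crux_iff.2 (crux_unfolded_of h.1 h.2)⟩

/-- **The typed decl + item 9444 (proved) imply the companion N** (`β₁ := 0`; FS ⇒ UP ⇒ EC): the pair (C″, N) is a pure
weakening of the route's items 9441 ∧ 9444. -/
theorem nonSimplyConnectedClustering_of_crux
    (h : Summit.QuantumFields.YangMills.Theses.FradkinShenkerFlow.SusceptibilityToPoincare)
    (hPC : Summit.QuantumFields.YangMills.Theses.FradkinShenkerFlow.PoincareToClustering) :
    NonSimplyConnectedClustering :=
  fun G _ _ _ _ _ _ hG _ r => ⟨0, fun β hβ hFS =>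
    poincareToClustering_iff.1 hPC G r β hβ (crux_iff.1 h G hG r β hβ hFS)⟩

/-- **The restated route closes**: with 9441 replaced by the pair (C″ = `CoreSC`, N = `NonSimplyConnectedClustering`) the
deciding theorem of route FradkinShenkerFlow goes through with the SAME three other items — for simply-connected `G`:
FS (9442, threshold `β₀`) ⇒ UP (C″, threshold `β₁`) ⇒ EC (9444) above `max (max β₀ β₁) 0`; for centreless `G`: FS ⇒ EC by N
above `max β₀ β₁`; then 9443.  (Case split on the proposition `SimplyConnectedSpace G`, classical.) -/
theorem closes_restated (hSC : CoreSC) (hN : NonSimplyConnectedClustering)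
    (hPC : Summit.QuantumFields.YangMills.Theses.FradkinShenkerFlow.PoincareToClustering)
    (hFS : Summit.QuantumFields.YangMills.Theses.FradkinShenkerFlow.FiniteSusceptibilityWeakCoupling)
    (hCY : Summit.QuantumFields.YangMills.Theses.FradkinShenkerFlow.ClusteringToYangMills) : YangMills := by
  refine clusteringToYangMills_iff.1 hCY ?_
  intro G _ _ _ _ _ _ hG r
  obtain ⟨β₀, hβ₀⟩ := finiteSusceptibilityWeakCoupling_iff.1 hFS G hG r
  by_cases hsc : SimplyConnectedSpace G
  · obtain ⟨β₁, hβ₁⟩ := hSC G hG hsc r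
    refine ⟨max (max β₀ β₁) 0, fun β hβ => ?_⟩
    have h0 : (0 : ℝ) ≤ β := le_trans (le_max_right _ _) hβ
    have hb₀ : β₀ ≤ β := le_trans ((le_max_left _ _).trans (le_max_left _ _)) hβ
    have hb₁ : β₁ ≤ β := le_trans ((le_max_right _ _).trans (le_max_left _ _)) hβ
    exact poincareToClustering_iff.1 hPC G r β h0 (hβ₁ β hb₁ (hβ₀ β hb₀))
  · obtain ⟨β₁, hβ₁⟩ := hN G hG hsc r
    exact ⟨max β₀ β₁, fun β hβ =>
      hβ₁ β (le_trans (le_max_right _ _) hβ) (hβ₀ β (le_trans (le_max_left _ _) hβ))⟩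

/-- **The original deciding theorem is a special case** (sanity: `closes` of the route file factors through
`closes_restated` via `coreSC_of_crux` and `nonSimplyConnectedClustering_of_crux`). -/
theorem closes_of_restated
    (hSP : Summit.QuantumFields.YangMills.Theses.FradkinShenkerFlow.SusceptibilityToPoincare)
    (hPC : Summit.QuantumFields.YangMills.Theses.FradkinShenkerFlow.PoincareToClustering)
    (hFS : Summit.QuantumFields.YangMills.Theses.FradkinShenkerFlow.FiniteSusceptibilityWeakCoupling)
    (hCY : Summit.QuantumFields.YangMills.Theses.FradkinShenkerFlow.ClusteringToYangMills) : YangMills :=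
  closes_restated (coreSC_of_crux hSP) (nonSimplyConnectedClustering_of_crux hSP hPC) hPC hFS hCY

/-- **The restated route from the registered stubs**: A–D (through `coreSC_of_stubs`; its only non-whitelisted axiom is the
`sorryAx` of B, C, D — the sentinel T is NOT used) + N + items 9444, 9442, 9443 ⟹ `YangMills`.  This skeleton is therefore
already the checked line of the restated crux C″. -/
theorem yangMills_of_stubs (hN : NonSimplyConnectedClustering)
    (hPC : Summit.QuantumFields.YangMills.Theses.FradkinShenkerFlow.PoincareToClustering)
    (hFS : Summit.QuantumFields.YangMills.Theses.FradkinShenkerFlow.FiniteSusceptibilityWeakCoupling)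
    (hCY : Summit.QuantumFields.YangMills.Theses.FradkinShenkerFlow.ClusteringToYangMills) : YangMills :=
  closes_restated coreSC_of_stubs hN hPC hFS hCY

end

end Summit.QuantumFields.YangMills.Cruxes.SusceptibilityToPoincare.RgVarianceCascade
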